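import Literature.NumberTheory.NumberFields.SqrtTwoTowerOrderFourClassCertificate
import HarnessLib

/-!
# The ORDER-FOUR CERTIFICATE two quadratic steps higher: a class of order `4` in `Cl(L)` for the THREE-step tower
# `K ⊂ K₁ = K(s₁) ⊂ K₂ = K₁(s₂) ⊂ L = K₂(s₃)`, `s₁² = 2`, `s₂² = 2 + s₁`, `s₃² = 2 + s₂` (the third layer `K·ℚ(ζ₃₂)⁺` of the cyclotomic
# `ℤ₂`-tower), from `n ≥ rank E_L` units modulo `±` squares with residue symbols COMPUTED IN `𝓞_K` (EIGHT coordinates), an explicit ideal `(b, v)`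
# with `(b,v)² = (w,b²)` not principal and `(w,b²)² = (w)`; and the character-matrix form of the certificates

Topic `NumberTheory/NumberFields` (namespace = path).  THEOREM-ONLY file (no definition, no named fact, no instance, no `sorry`), written by the prover seat
`bsd-line-att-p4` g41 (cell `bsd-f1-sign2`, route `AlignedTransportAtTwo`; `--supports` stmt-BirchSwinnertonDyer-22298, closes nothing).  It is this seat's
`SqrtTwoTowerOrderFourClassCertificate` (two steps, four coordinates; layer `K_2`) taken ONE MORE LAYER UP: coordinates of an element of `L` are EIGHT elements of `K`
on the basis `1, s₁, s₂, s₁s₂, s₃, s₁s₃, s₂s₃, s₁s₂s₃`, `64·𝓞_L` has coordinates in `𝓞_K`, and the residue symbol is evaluated at `(ψ, r₁, r₂, r₃)` with `r₁² = 2`,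
`r₂² = 2 + r₁`, `r₃² = 2 + r₂` in `ℤ/q`.  PURPOSE (cell bsd-f1-sign2, crux C2, HARD CORE `t = 3 ∧ e₁ = 1` of the u7 sub-cell: `N = 1259, 3523, 14891`): the class group of
`K_2` is elementary `(ℤ/2)³` there (att-p3 g47's elementary-layer door is silent at `k = 2`); a class of ORDER `4` in `Cl(K_3)` — certified by this file's theorem from
data of the cubic ring `ℤ[θ]` (15 units of `K_3`, an ideal `(q₀, s₃ − t)`, 17 residue characters) — would give `μ₂ = 0`, `λ₂ ≤ 6` through the same door at `k = 3`.

## Contents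
* §1 three-step coordinates: existence, uniqueness, ★ the product rule (eight bilinear forms, `s₁² = 2`, `s₂² = 2 + s₁`, `s₃² = 2 + s₂`).
* §2 **`64·𝓞_L` has coordinates in `𝓞_K`** (one quadratic step with `d = 2 + s₂`, `d' = (2 − s₂)(2 + s₁)`, `d·d' = 2`, then the two-step lemma); ★ the residue-symbol
  obstruction `isSquare_residue8_of_sq_eq_coord` and its signed-product form.
* §3 ★★ THE CERTIFICATE `exists_orderOf_eq_four_of_tower3OrderFourCert` (same proof as the two-step theorem: Dirichlet + certificates ⟹ `(w,b²)` not principal ⟹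
  the class of `(b,v)` has order `4`); `4 ∣ h_L`.
* §4 ★ THE CHARACTER MATRIX `tower3Cert_of_charMatrix` (Euler bits `B`, `N·B = 1` over `𝔽₂` ⟹ all `2ⁿ⁺²−1` certificates).

HONEST SCOPE: textbook computational algebraic number theory (Cohen §6.5; Dirichlet; Euler's criterion); nothing specific to any summit; BSD is not advanced by this file.
No customer is asserted here: the degree-`24` data (`rank E_{K_3} = 15` for a complex cubic `K`) are a data-seat task (`bnfinit`-size), the kernel part is this file.

References: [NeukirchANT1999] Ch. I §2, §3, §7 Thm. (7.4), §8; [Cohen1993] §4.8–§4.9, §6.5; [Marcus2018] Ch. 3 Thm. 27; [Serre1973CourseArithmetic] Ch. I §3;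
[Washington1997] §13.1 (`ℚ_3 = ℚ(ζ₃₂)⁺`).
-/

set_option autoImplicit false

noncomputable section

open NumberField NumberField.Units Module
open scoped nonZeroDivisors

namespace Literature.NumberTheory.NumberFields

/-! ## §1 The three-step tower: eight coordinates over `K` -/

section Tower3

variable {K K₁ K₂ L : Type*} [Field K] [Field K₁] [Field K₂] [Field L]
  [Algebra K K₁] [Algebra K₁ K₂] [Algebra K K₂] [IsScalarTower K K₁ K₂]
  [Algebra K₂ L] [Algebra K L] [Algebra K₁ L] [IsScalarTower K K₂ L] [IsScalarTower K₁ K₂ L]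

/-- **Coordinates**: every `z ∈ L` is `x₀ + x₁s₁ + (x₂ + x₃s₁)s₂ + (x₄ + x₅s₁ + (x₆ + x₇s₁)s₂)s₃` with `x_i ∈ K` (three quadratic steps).
[cite: NeukirchANT1999, Ch. I §2 (bases of field extensions; the tower law)] -/
theorem exists_coord8_of_tower (h1 : Module.finrank K K₁ = 2) (h2 : Module.finrank K₁ K₂ = 2) (h3 : Module.finrank K₂ L = 2)
    {s₁ : K₁} (hs₁K : ∀ k : K, algebraMap K K₁ k ≠ s₁) {s₂ : K₂} (hs₂K : ∀ x : K₁, algebraMap K₁ K₂ x ≠ s₂)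
    {s₃ : L} (hs₃K : ∀ x : K₂, algebraMap K₂ L x ≠ s₃) (z : L) :
    ∃ x₀ x₁ x₂ x₃ x₄ x₅ x₆ x₇ : K, z = algebraMap K L x₀ + algebraMap K L x₁ * algebraMap K₁ L s₁ + (algebraMap K L x₂ + algebraMap K L x₃ * algebraMap K₁ L s₁) * algebraMap K₂ L s₂ +
      (algebraMap K L x₄ + algebraMap K L x₅ * algebraMap K₁ L s₁ + (algebraMap K L x₆ + algebraMap K L x₇ * algebraMap K₁ L s₁) * algebraMap K₂ L s₂) * s₃ := by
  obtain ⟨P, Q, rfl⟩ := exists_eq_add_mul_of_finrank_eq_two h3 hs₃K z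
  obtain ⟨x₀, x₁, x₂, x₃, rfl⟩ := exists_coord4_of_tower h1 h2 hs₁K hs₂K P
  obtain ⟨x₄, x₅, x₆, x₇, rfl⟩ := exists_coord4_of_tower h1 h2 hs₁K hs₂K Q
  refine ⟨x₀, x₁, x₂, x₃, x₄, x₅, x₆, x₇, ?_⟩
  simp only [map_add, map_mul, ← IsScalarTower.algebraMap_apply]

/-- **Uniqueness of the eight coordinates** (`s₃ ∉ K₂`, `s₂ ∉ K₁`, `s₁ ∉ K`). [cite: NeukirchANT1999, Ch. I §2 (bases of field extensions)] -/
theorem coord8_unique_of_tower {s₁ : K₁} (hs₁K : ∀ k : K, algebraMap K K₁ k ≠ s₁) {s₂ : K₂} (hs₂K : ∀ x : K₁, algebraMap K₁ K₂ x ≠ s₂)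
    {s₃ : L} (hs₃K : ∀ x : K₂, algebraMap K₂ L x ≠ s₃) {x₀ x₁ x₂ x₃ x₄ x₅ x₆ x₇ y₀ y₁ y₂ y₃ y₄ y₅ y₆ y₇ : K}
    (h : algebraMap K L x₀ + algebraMap K L x₁ * algebraMap K₁ L s₁ + (algebraMap K L x₂ + algebraMap K L x₃ * algebraMap K₁ L s₁) * algebraMap K₂ L s₂ +
      (algebraMap K L x₄ + algebraMap K L x₅ * algebraMap K₁ L s₁ + (algebraMap K L x₆ + algebraMap K L x₇ * algebraMap K₁ L s₁) * algebraMap K₂ L s₂) * s₃ =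
      algebraMap K L y₀ + algebraMap K L y₁ * algebraMap K₁ L s₁ + (algebraMap K L y₂ + algebraMap K L y₃ * algebraMap K₁ L s₁) * algebraMap K₂ L s₂ +
      (algebraMap K L y₄ + algebraMap K L y₅ * algebraMap K₁ L s₁ + (algebraMap K L y₆ + algebraMap K L y₇ * algebraMap K₁ L s₁) * algebraMap K₂ L s₂) * s₃) :
    x₀ = y₀ ∧ x₁ = y₁ ∧ x₂ = y₂ ∧ x₃ = y₃ ∧ x₄ = y₄ ∧ x₅ = y₅ ∧ x₆ = y₆ ∧ x₇ = y₇ := by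
  have h' : algebraMap K₂ L (algebraMap K K₂ x₀ + algebraMap K K₂ x₁ * algebraMap K₁ K₂ s₁ +
        (algebraMap K K₂ x₂ + algebraMap K K₂ x₃ * algebraMap K₁ K₂ s₁) * s₂) +
      algebraMap K₂ L (algebraMap K K₂ x₄ + algebraMap K K₂ x₅ * algebraMap K₁ K₂ s₁ +
        (algebraMap K K₂ x₆ + algebraMap K K₂ x₇ * algebraMap K₁ K₂ s₁) * s₂) * s₃ =
      algebraMap K₂ L (algebraMap K K₂ y₀ + algebraMap K K₂ y₁ * algebraMap K₁ K₂ s₁ +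
        (algebraMap K K₂ y₂ + algebraMap K K₂ y₃ * algebraMap K₁ K₂ s₁) * s₂) +
      algebraMap K₂ L (algebraMap K K₂ y₄ + algebraMap K K₂ y₅ * algebraMap K₁ K₂ s₁ +
        (algebraMap K K₂ y₆ + algebraMap K K₂ y₇ * algebraMap K₁ K₂ s₁) * s₂) * s₃ := by
    simpa only [map_add, map_mul, ← IsScalarTower.algebraMap_apply] using h
  obtain ⟨hP, hQ⟩ := coord_unique_of_forall_algebraMap_ne hs₃K h'
  obtain ⟨h0, h1, h2, h3⟩ := coord4_unique_of_tower hs₁K hs₂K hP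
  obtain ⟨h4, h5, h6, h7⟩ := coord4_unique_of_tower hs₁K hs₂K hQ
  exact ⟨h0, h1, h2, h3, h4, h5, h6, h7⟩

omit [Algebra K K₁] [Algebra K K₂] [IsScalarTower K K₁ K₂] [IsScalarTower K K₂ L] in
/-- ★ **The product rule** on the basis `1, s₁, s₂, s₁s₂, s₃, s₁s₃, s₂s₃, s₁s₂s₃` (`s₁² = 2`, `s₂² = 2 + s₁`, `s₃² = 2 + s₂`): eight bilinear forms with
coefficients in `{1, 2, 4, 8}`. [cite: NeukirchANT1999, Ch. I §2 (arithmetic in `K(√d)`)] -/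
theorem coord8_mul_of_tower {s₁ : K₁} (hs₁ : s₁ ^ 2 = 2) {s₂ : K₂} (hs₂ : s₂ ^ 2 = algebraMap K₁ K₂ (2 + s₁))
    {s₃ : L} (hs₃ : s₃ ^ 2 = algebraMap K₂ L (2 + s₂)) (x₀ x₁ x₂ x₃ x₄ x₅ x₆ x₇ y₀ y₁ y₂ y₃ y₄ y₅ y₆ y₇ : K) :
    (algebraMap K L x₀ + algebraMap K L x₁ * algebraMap K₁ L s₁ + (algebraMap K L x₂ + algebraMap K L x₃ * algebraMap K₁ L s₁) * algebraMap K₂ L s₂ + (algebraMap K L x₄ + algebraMap K L x₅ * algebraMap K₁ L s₁ + (algebraMap K L x₆ + algebraMap K L x₇ * algebraMap K₁ L s₁) * algebraMap K₂ L s₂) * s₃) *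
      (algebraMap K L y₀ + algebraMap K L y₁ * algebraMap K₁ L s₁ + (algebraMap K L y₂ + algebraMap K L y₃ * algebraMap K₁ L s₁) * algebraMap K₂ L s₂ + (algebraMap K L y₄ + algebraMap K L y₅ * algebraMap K₁ L s₁ + (algebraMap K L y₆ + algebraMap K L y₇ * algebraMap K₁ L s₁) * algebraMap K₂ L s₂) * s₃) =
    algebraMap K L (x₀ * y₀ + 2 * x₁ * y₁ + 2 * x₂ * y₂ + 2 * x₂ * y₃ + 2 * x₃ * y₂ + 4 * x₃ * y₃ + 2 * x₄ * y₄ + 2 * x₄ * y₆ + 2 * x₄ * y₇ + 4 * x₅ * y₅ + 2 * x₅ * y₆ + 4 * x₅ * y₇ + 2 * x₆ * y₄ + 2 * x₆ * y₅ + 4 * x₆ * y₆ + 4 * x₆ * y₇ + 2 * x₇ * y₄ + 4 * x₇ * y₅ + 4 * x₇ * y₆ + 8 * x₇ * y₇) + algebraMap K L (x₀ * y₁ + x₁ * y₀ + x₂ * y₂ + 2 * x₂ * y₃ + 2 * x₃ * y₂ + 2 * x₃ * y₃ + 2 * x₄ * y₅ + x₄ * y₆ + 2 * x₄ * y₇ +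 2 * x₅ * y₄ + 2 * x₅ * y₆ + 2 * x₅ * y₇ + x₆ * y₄ + 2 * x₆ * y₅ + 2 * x₆ * y₆ + 4 * x₆ * y₇ + 2 * x₇ * y₄ + 2 * x₇ * y₅ + 4 * x₇ * y₆ + 4 * x₇ * y₇) * algebraMap K₁ L s₁ + (algebraMap K L (x₀ * y₂ + 2 * x₁ * y₃ + x₂ * y₀ + 2 * x₃ * y₁ + x₄ * y₄ + 2 * x₄ * y₆ + 2 * x₅ * y₅ + 4 * x₅ * y₇ + 2 * x₆ * y₄ + 2 * x₆ * y₆ + 2 * x₆ * y₇ + 4 * x₇ * y₅ + 2 * x₇ * y₆ + 4 * x₇ * y₇) + algebraMap K L (x₀ * y₃ + x₁ * y₂ + x₂ * y₁ + x₃ * y₀ + x₄ * y₅ + 2 * x₄ * y₇ + x₅ * y₄ + 2 * x₅ * y₆ + 2 * x₆ * y₅ + x₆ * y₆ + 2 * x₆ * y₇ + 2 * x₇ * y₄ + 2 * x₇ * y₆ + 2 * x₇ * y₇) * algebraMap K₁ L s₁) * algebraMap K₂ L s₂ +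
      (algebraMap K L (x₀ * y₄ + 2 * x₁ * y₅ + 2 * x₂ * y₆ + 2 * x₂ * y₇ + 2 * x₃ * y₆ + 4 * x₃ * y₇ + x₄ * y₀ + 2 * x₅ * y₁ + 2 * x₆ * y₂ + 2 * x₆ * y₃ + 2 * x₇ * y₂ + 4 * x₇ * y₃) + algebraMap K L (x₀ * y₅ + x₁ * y₄ + x₂ * y₆ + 2 * x₂ * y₇ + 2 * x₃ * y₆ + 2 * x₃ * y₇ + x₄ * y₁ + x₅ * y₀ + x₆ * y₂ + 2 * x₆ * y₃ + 2 * x₇ * y₂ + 2 * x₇ * y₃) * algebraMap K₁ L s₁ + (algebraMap K L (x₀ * y₆ + 2 * x₁ * y₇ + x₂ * y₄ + 2 * x₃ * y₅ + x₄ * y₂ + 2 * x₅ * y₃ + x₆ * y₀ + 2 * x₇ * y₁) + algebraMap K L (x₀ * y₇ + x₁ * y₆ + x₂ * y₅ + x₃ * y₄ + x₄ * y₃ + x₅ * y₂ + x₆ * y₁ + x₇ * y₀) * algebraMap K₁ L s₁) * algebraMap K₂ L s₂) * s₃ := by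
  have hS₁ : (algebraMap K₁ L s₁) ^ 2 = 2 := by rw [← map_pow, hs₁, map_ofNat]
  have hS₂ : (algebraMap K₂ L s₂) ^ 2 = 2 + algebraMap K₁ L s₁ := by
    rw [← map_pow, hs₂, ← IsScalarTower.algebraMap_apply, map_add, map_ofNat]
  have hS₃ : s₃ ^ 2 = 2 + algebraMap K₂ L s₂ := by rw [hs₃, map_add, map_ofNat]
  simp only [map_add, map_mul, map_ofNat]
  linear_combination (algebraMap K L x₁ * algebraMap K L y₁ + algebraMap K L x₂ * algebraMap K L y₃ + algebraMap K L x₃ * algebraMap K L y₂ + 2 * algebraMap K L x₃ * algebraMap K L y₃ + algebraMap K L x₄ * algebraMap K L y₇ + 2 * algebraMap K L x₅ * algebraMap K L y₅ + algebraMap K L x₅ * algebraMap K L y₆ + 2 * algebraMap K L x₅ * algebraMap K L y₇ + algebraMap K L x₆ * algebraMap K L y₅ + 2 * algebraMap K L x₆ * algebraMap K L y₇ + algebraMap K L x₇ * algebraMap K L y₄ + 2 * algebraMap K L x₇ * algebraMap K L y₅ + 2 * algebraMap K L x₇ * algebraMap K L y₆ + 4 * algebraMap K L x₇ * algebraMap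 K L y₇ + algebraMap K₁ L s₁ * algebraMap K L x₃ * algebraMap K L y₃ + algebraMap K₁ L s₁ * algebraMap K L x₅ * algebraMap K L y₇ + algebraMap K₁ L s₁ * algebraMap K L x₇ * algebraMap K L y₅ + 2 * algebraMap K₁ L s₁ * algebraMap K L x₇ * algebraMap K L y₇ + algebraMap K₂ L s₂ * algebraMap K L x₁ * algebraMap K L y₃ + algebraMap K₂ L s₂ * algebraMap K L x₃ * algebraMap K L y₁ + algebraMap K₂ L s₂ * algebraMap K L x₅ * algebraMap K L y₅ + 2 * algebraMap K₂ L s₂ * algebraMap K L x₅ * algebraMap K L y₇ + algebraMap K₂ L s₂ * algebraMap K L x₆ * algebraMap K L y₇ + 2 * algebraMap K₂ L s₂ * algebraMap K L x₇ * algebraMap K L y₅ + algebraMap K₂ L s₂ * algebraMap K L x₇ * algebraMap K L y₆ + 2 * algebraMap K₂ L s₂ * algebraMap K L x₇ * algebraMap K L y₇ + s₃ * algebraMap K L x₁ * algebraMap K L y₅ + s₃ * algebraMap K L x₂ * algebraMap K L y₇ + s₃ * algebraMap K L x₃ * algebraMap K L y₆ + 2 * s₃ * algebraMap K L x₃ *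 algebraMap K L y₇ + s₃ * algebraMap K L x₅ * algebraMap K L y₁ + s₃ * algebraMap K L x₆ * algebraMap K L y₃ + s₃ * algebraMap K L x₇ * algebraMap K L y₂ + 2 * s₃ * algebraMap K L x₇ * algebraMap K L y₃ + algebraMap K₁ L s₁ * algebraMap K₂ L s₂ * algebraMap K L x₇ * algebraMap K L y₇ + algebraMap K₁ L s₁ * s₃ * algebraMap K L x₃ * algebraMap K L y₇ + algebraMap K₁ L s₁ * s₃ * algebraMap K L x₇ * algebraMap K L y₃ + algebraMap K₂ L s₂ * s₃ * algebraMap K L x₁ * algebraMap K L y₇ + algebraMap K₂ L s₂ * s₃ * algebraMap K L x₃ * algebraMap K L y₅ + algebraMap K₂ L s₂ * s₃ * algebraMap K L x₅ * algebraMap K L y₃ + algebraMap K₂ L s₂ * s₃ * algebraMap K L x₇ * algebraMap K L y₁) * hS₁ +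
    (algebraMap K L x₂ * algebraMap K L y₂ + algebraMap K L x₄ * algebraMap K L y₆ + algebraMap K L x₆ * algebraMap K L y₄ + 2 * algebraMap K L x₆ * algebraMap K L y₆ + algebraMap K₁ L s₁ * algebraMap K L x₂ * algebraMap K L y₃ + algebraMap K₁ L s₁ * algebraMap K L x₃ * algebraMap K L y₂ + algebraMap K₁ L s₁ * algebraMap K L x₄ * algebraMap K L y₇ + algebraMap K₁ L s₁ * algebraMap K L x₅ * algebraMap K L y₆ + algebraMap K₁ L s₁ * algebraMap K L x₆ * algebraMap K L y₅ + 2 * algebraMap K₁ L s₁ * algebraMap K L x₆ * algebraMap K L y₇ + algebraMap K₁ L s₁ * algebraMap K L x₇ * algebraMap K L y₄ + 2 * algebraMap K₁ L s₁ * algebraMap K L x₇ * algebraMap K L y₆ + algebraMap K₁ L s₁ * algebraMap K₁ L s₁ * algebraMap K L x₃ * algebraMap K L y₃ + algebraMap K₁ L s₁ * algebraMap K₁ L s₁ * algebraMap K L x₅ * algebraMap K L y₇ + algebraMap K₁ L s₁ * algebraMap K₁ L s₁ * algebraMap K L x₇ * algebraMap K L y₅ + 2 * algebraMap K₁ L s₁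 * algebraMap K₁ L s₁ * algebraMap K L x₇ * algebraMap K L y₇ + algebraMap K₂ L s₂ * algebraMap K L x₆ * algebraMap K L y₆ + s₃ * algebraMap K L x₂ * algebraMap K L y₆ + s₃ * algebraMap K L x₆ * algebraMap K L y₂ + algebraMap K₁ L s₁ * algebraMap K₂ L s₂ * algebraMap K L x₆ * algebraMap K L y₇ + algebraMap K₁ L s₁ * algebraMap K₂ L s₂ * algebraMap K L x₇ * algebraMap K L y₆ + algebraMap K₁ L s₁ * s₃ * algebraMap K L x₂ * algebraMap K L y₇ + algebraMap K₁ L s₁ * s₃ * algebraMap K L x₃ * algebraMap K L y₆ + algebraMap K₁ L s₁ * s₃ * algebraMap K L x₆ * algebraMap K L y₃ + algebraMap K₁ L s₁ * s₃ * algebraMap K L x₇ * algebraMap K L y₂ + algebraMap K₁ L s₁ * algebraMap K₁ L s₁ * algebraMap K₂ L s₂ * algebraMap K L x₇ * algebraMap K L y₇ + algebraMap K₁ L s₁ * algebraMap K₁ L s₁ * s₃ * algebraMap K L x₃ * algebraMap K L y₇ + algebraMap K₁ L s₁ * algebraMap K₁ L s₁ * s₃ * algebraMap K L x₇ * algebraMap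 K L y₃) * hS₂ +
    (algebraMap K L x₄ * algebraMap K L y₄ + algebraMap K₁ L s₁ * algebraMap K L x₄ * algebraMap K L y₅ + algebraMap K₁ L s₁ * algebraMap K L x₅ * algebraMap K L y₄ + algebraMap K₁ L s₁ * algebraMap K₁ L s₁ * algebraMap K L x₅ * algebraMap K L y₅ + algebraMap K₂ L s₂ * algebraMap K L x₄ * algebraMap K L y₆ + algebraMap K₂ L s₂ * algebraMap K L x₆ * algebraMap K L y₄ + algebraMap K₂ L s₂ * algebraMap K₂ L s₂ * algebraMap K L x₆ * algebraMap K L y₆ + algebraMap K₁ L s₁ * algebraMap K₂ L s₂ * algebraMap K L x₄ * algebraMap K L y₇ + algebraMap K₁ L s₁ * algebraMap K₂ L s₂ * algebraMap K L x₅ * algebraMap K L y₆ + algebraMap K₁ L s₁ * algebraMap K₂ L s₂ * algebraMap K L x₆ * algebraMap K L y₅ + algebraMap K₁ L s₁ * algebraMap K₂ L s₂ * algebraMap K L x₇ * algebraMap K L y₄ + algebraMap K₁ L s₁ * algebraMap K₂ L s₂ * algebraMap K₂ L s₂ * algebraMap K L x₆ * algebraMap K L y₇ + algebraMap K₁ L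 s₁ * algebraMap K₂ L s₂ * algebraMap K₂ L s₂ * algebraMap K L x₇ * algebraMap K L y₆ + algebraMap K₁ L s₁ * algebraMap K₁ L s₁ * algebraMap K₂ L s₂ * algebraMap K L x₅ * algebraMap K L y₇ + algebraMap K₁ L s₁ * algebraMap K₁ L s₁ * algebraMap K₂ L s₂ * algebraMap K L x₇ * algebraMap K L y₅ + algebraMap K₁ L s₁ * algebraMap K₁ L s₁ * algebraMap K₂ L s₂ * algebraMap K₂ L s₂ * algebraMap K L x₇ * algebraMap K L y₇) * hS₃

end Tower3

/-! ## §2 Integrality and the residue-symbol obstruction in the three-step tower, computed in `𝓞_K` -/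

section Residue3

variable {K K₁ K₂ L : Type*} [Field K] [Field K₁] [NumberField K₁] [Field K₂] [NumberField K₂] [Field L] [NumberField L]
  [Algebra K K₁] [Algebra K₁ K₂] [Algebra K K₂] [IsScalarTower K K₁ K₂]
  [Algebra K₂ L] [Algebra K L] [Algebra K₁ L] [IsScalarTower K K₂ L] [IsScalarTower K₁ K₂ L]
  [FiniteDimensional K K₁] [IsGalois K K₁] [FiniteDimensional K₁ K₂] [IsGalois K₁ K₂] [FiniteDimensional K₂ L] [IsGalois K₂ L]

/-- **`64·𝓞_L` has coordinates in `𝓞_K`**: `z ∈ 𝓞_L ⟹ 64z = Σ p_i b_i` with `p_i ∈ 𝓞_K` on the basis `1, s₁, …, s₁s₂s₃` (the quadratic step `L/K₂` with `d = 2 + s₂`,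
`d' = (2 − s₂)(2 + s₁)`, `d·d' = 2`, then the two-step lemma `exists_sixteen_mul_eq_coord4_of_isIntegral` for `K ⊂ K₁ ⊂ K₂`).
[cite: NeukirchANT1999, Ch. I §2 (integral closure; trace and norm of integral elements)] -/
theorem exists_sixtyfour_mul_eq_coord8_of_isIntegral (h1 : Module.finrank K K₁ = 2) (h2 : Module.finrank K₁ K₂ = 2) (h3 : Module.finrank K₂ L = 2)
    {s₁ : K₁} (hs₁ : s₁ ^ 2 = 2) (hs₁K : ∀ k : K, algebraMap K K₁ k ≠ s₁)
    {s₂ : K₂} (hs₂ : s₂ ^ 2 = algebraMap K₁ K₂ (2 + s₁)) (hs₂K : ∀ x : K₁, algebraMap K₁ K₂ x ≠ s₂)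
    {s₃ : L} (hs₃ : s₃ ^ 2 = algebraMap K₂ L (2 + s₂)) (hs₃K : ∀ x : K₂, algebraMap K₂ L x ≠ s₃)
    {z : L} (hz : IsIntegral ℤ z) :
    ∃ p₀ p₁ p₂ p₃ p₄ p₅ p₆ p₇ : 𝓞 K, 64 * z = algebraMap K L (p₀ : K) + algebraMap K L (p₁ : K) * algebraMap K₁ L s₁ + (algebraMap K L (p₂ : K) + algebraMap K L (p₃ : K) * algebraMap K₁ L s₁) * algebraMap K₂ L s₂ +
      (algebraMap K L (p₄ : K) + algebraMap K L (p₅ : K) * algebraMap K₁ L s₁ + (algebraMap K L (p₆ : K) + algebraMap K L (p₇ : K) * algebraMap K₁ L s₁) * algebraMap K₂ L s₂) * s₃ := by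
  have hs₁int : IsIntegral ℤ s₁ := by
    refine ⟨Polynomial.X ^ 2 - Polynomial.C 2, Polynomial.monic_X_pow_sub_C _ two_ne_zero, ?_⟩
    simp [hs₁]
  have hS₁int : IsIntegral ℤ (algebraMap K₁ K₂ s₁) := map_isIntegral_int _ hs₁int
  have h2int : IsIntegral ℤ (2 : K₂) := by
    have := isIntegral_algebraMap (R := ℤ) (A := K₂) (x := (2 : ℤ))
    rwa [map_ofNat] at this
  have hs₂int : IsIntegral ℤ s₂ := by
    refine IsIntegral.of_pow (n := 2) (by norm_num) ?_
    rw [hs₂, map_add, map_ofNat]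
    exact h2int.add hS₁int
  have h2int₁ : IsIntegral ℤ (2 : K₁) := by
    have := isIntegral_algebraMap (R := ℤ) (A := K₁) (x := (2 : ℤ))
    rwa [map_ofNat] at this
  have hd' : IsIntegral ℤ ((2 - s₂) * algebraMap K₁ K₂ (2 + s₁)) :=
    (h2int.sub hs₂int).mul (map_isIntegral_int _ (h2int₁.add hs₁int))
  have hS : (algebraMap K₁ K₂ s₁) ^ 2 = 2 := by rw [← map_pow, hs₁, map_ofNat]
  have hs₂' : s₂ ^ 2 = 2 + algebraMap K₁ K₂ s₁ := by rw [hs₂, map_add, map_ofNat]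
  have hdd : (2 + s₂) * ((2 - s₂) * algebraMap K₁ K₂ (2 + s₁)) = 2 := by
    rw [map_add, map_ofNat]
    linear_combination (-(2 + algebraMap K₁ K₂ s₁)) * hs₂' + (-1 : K₂) * hS
  obtain ⟨P, Q, hPQ⟩ := exists_four_mul_eq_coord_of_isIntegral_of_sq_eq h3 hs₃ hs₃K hd' hdd hz
  obtain ⟨p₀, p₁, p₂, p₃, hP⟩ := exists_sixteen_mul_eq_coord4_of_isIntegral h1 h2 hs₁ hs₁K hs₂ hs₂K
    (z := (P : K₂)) (RingOfIntegers.isIntegral_coe P)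
  obtain ⟨p₄, p₅, p₆, p₇, hQ⟩ := exists_sixteen_mul_eq_coord4_of_isIntegral h1 h2 hs₁ hs₁K hs₂ hs₂K
    (z := (Q : K₂)) (RingOfIntegers.isIntegral_coe Q)
  refine ⟨p₀, p₁, p₂, p₃, p₄, p₅, p₆, p₇, ?_⟩
  have hK₂L : ∀ x : K, algebraMap K₂ L (algebraMap K K₂ x) = algebraMap K L x := fun x =>
    (IsScalarTower.algebraMap_apply K K₂ L x).symm
  have hK₁L : algebraMap K₂ L (algebraMap K₁ K₂ s₁) = algebraMap K₁ L s₁ := (IsScalarTower.algebraMap_apply K₁ K₂ L s₁).symm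
  have h64 : 64 * z = algebraMap K₂ L (16 * (P : K₂)) + algebraMap K₂ L (16 * (Q : K₂)) * s₃ := by
    rw [map_mul, map_mul, map_ofNat]
    linear_combination (16 : L) * hPQ
  rw [h64, hP, hQ]
  simp only [map_add, map_mul, hK₂L, hK₁L]

/-- ★ **The residue-symbol obstruction in the three-step tower.**  `ψ : 𝓞_K → ℤ/q` a ring homomorphism with `2` invertible (`2t = 1`), `r₁² = 2`,
`r₂² = 2 + r₁`, `r₃² = 2 + r₂` in `ℤ/q`.  If `Σ x_i b_i` (`x_i ∈ 𝓞_K`, `b_i` the eight basis monomials) is a square in `L` then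
`sym(x) = ψx₀ + ψx₁r₁ + (ψx₂ + ψx₃r₁)r₂ + (ψx₄ + ψx₅r₁ + (ψx₆ + ψx₇r₁)r₂)r₃` is a square in `ℤ/q` (`64z` has coordinates `p`, `4096·x = p ⋆ p`, apply `ψ`):
the quadratic character of the degree-one prime `(ker ψ, s₁ − r₁, s₂ − r₂, s₃ − r₃)` of `L`, computed without constructing it.
[cite: NeukirchANT1999, Ch. I §8 (residue fields of split primes)] [cite: Marcus2018, Ch. 3, Thm. 27] -/
theorem isSquare_residue8_of_sq_eq_coord (h1 : Module.finrank K K₁ = 2) (h2 : Module.finrank K₁ K₂ = 2) (h3 : Module.finrank K₂ L = 2)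
    {s₁ : K₁} (hs₁ : s₁ ^ 2 = 2) (hs₁K : ∀ k : K, algebraMap K K₁ k ≠ s₁)
    {s₂ : K₂} (hs₂ : s₂ ^ 2 = algebraMap K₁ K₂ (2 + s₁)) (hs₂K : ∀ x : K₁, algebraMap K₁ K₂ x ≠ s₂)
    {s₃ : L} (hs₃ : s₃ ^ 2 = algebraMap K₂ L (2 + s₂)) (hs₃K : ∀ x : K₂, algebraMap K₂ L x ≠ s₃)
    {q : ℕ} (ψ : 𝓞 K →+* ZMod q) {t r₁ r₂ r₃ : ZMod q} (ht : 2 * t = 1) (hr₁ : r₁ ^ 2 = 2) (hr₂ : r₂ ^ 2 = 2 + r₁) (hr₃ : r₃ ^ 2 = 2 + r₂)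
    {x₀ x₁ x₂ x₃ x₄ x₅ x₆ x₇ : 𝓞 K} {z : L}
    (hz : z ^ 2 = algebraMap K L (x₀ : K) + algebraMap K L (x₁ : K) * algebraMap K₁ L s₁ + (algebraMap K L (x₂ : K) + algebraMap K L (x₃ : K) * algebraMap K₁ L s₁) * algebraMap K₂ L s₂ +
      (algebraMap K L (x₄ : K) + algebraMap K L (x₅ : K) * algebraMap K₁ L s₁ + (algebraMap K L (x₆ : K) + algebraMap K L (x₇ : K) * algebraMap K₁ L s₁) * algebraMap K₂ L s₂) * s₃) :
    IsSquare (ψ x₀ + ψ x₁ * r₁ + (ψ x₂ + ψ x₃ * r₁) * r₂ + (ψ x₄ + ψ x₅ * r₁ + (ψ x₆ + ψ x₇ * r₁) * r₂) * r₃) := by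
  have hs₁int' : IsIntegral ℤ s₁ := by
    refine ⟨Polynomial.X ^ 2 - Polynomial.C 2, Polynomial.monic_X_pow_sub_C _ two_ne_zero, ?_⟩
    simp [hs₁]
  have hs₁int : IsIntegral ℤ (algebraMap K₁ L s₁) := map_isIntegral_int (algebraMap K₁ L) hs₁int'
  have h2int₂ : IsIntegral ℤ (2 : K₂) := by
    have := isIntegral_algebraMap (R := ℤ) (A := K₂) (x := (2 : ℤ))
    rwa [map_ofNat] at this
  have hs₂int' : IsIntegral ℤ s₂ := by
    refine IsIntegral.of_pow (n := 2) (by norm_num) ?_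
    rw [hs₂, map_add, map_ofNat]
    exact h2int₂.add (map_isIntegral_int _ hs₁int')
  have hs₂int : IsIntegral ℤ (algebraMap K₂ L s₂) := map_isIntegral_int (algebraMap K₂ L) hs₂int'
  have h2int : IsIntegral ℤ (2 : L) := by
    have := isIntegral_algebraMap (R := ℤ) (A := L) (x := (2 : ℤ))
    rwa [map_ofNat] at this
  have hs₃int : IsIntegral ℤ s₃ := by
    refine IsIntegral.of_pow (n := 2) (by norm_num) ?_
    rw [hs₃, map_add, map_ofNat]
    exact h2int.add hs₂int
  have hcoe : ∀ x : 𝓞 K, IsIntegral ℤ (algebraMap K L (x : K)) := fun x =>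
    (isIntegral_algebraMap_iff (algebraMap K L).injective).mpr x.2
  have hzint : IsIntegral ℤ z := by
    refine IsIntegral.of_pow (n := 2) (by norm_num) ?_
    rw [hz]
    exact (((hcoe x₀).add ((hcoe x₁).mul hs₁int)).add (((hcoe x₂).add ((hcoe x₃).mul hs₁int)).mul hs₂int)).add
      ((((hcoe x₄).add ((hcoe x₅).mul hs₁int)).add (((hcoe x₆).add ((hcoe x₇).mul hs₁int)).mul hs₂int)).mul hs₃int)
  obtain ⟨p₀, p₁, p₂, p₃, p₄, p₅, p₆, p₇, h64⟩ :=
    exists_sixtyfour_mul_eq_coord8_of_isIntegral h1 h2 h3 hs₁ hs₁K hs₂ hs₂K hs₃ hs₃K hzint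
  have h4096 := coord8_mul_of_tower (K := K) hs₁ hs₂ hs₃ (p₀ : K) (p₁ : K) (p₂ : K) (p₃ : K) (p₄ : K) (p₅ : K) (p₆ : K) (p₇ : K) p₀ p₁ p₂ p₃ p₄ p₅ p₆ p₇
  rw [← h64] at h4096
  have hlhs : 64 * z * (64 * z) = algebraMap K L ((4096 : K) * x₀) + algebraMap K L ((4096 : K) * x₁) * algebraMap K₁ L s₁ + (algebraMap K L ((4096 : K) * x₂) + algebraMap K L ((4096 : K) * x₃) * algebraMap K₁ L s₁) * algebraMap K₂ L s₂ +
      (algebraMap K L ((4096 : K) * x₄) + algebraMap K L ((4096 : K) * x₅) * algebraMap K₁ L s₁ + (algebraMap K L ((4096 : K) * x₆) + algebraMap K L ((4096 : K) * x₇) * algebraMap K₁ L s₁) * algebraMap K₂ L s₂) * s₃ := by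
    simp only [map_mul, map_ofNat]
    linear_combination (4096 : L) * hz
  rw [hlhs] at h4096
  obtain ⟨hA0, hA1, hA2, hA3, hA4, hA5, hA6, hA7⟩ := coord8_unique_of_tower hs₁K hs₂K hs₃K h4096
  have hB0 : (4096 : 𝓞 K) * x₀ = p₀ * p₀ + 2 * p₁ * p₁ + 2 * p₂ * p₂ + 2 * p₂ * p₃ + 2 * p₃ * p₂ + 4 * p₃ * p₃ + 2 * p₄ * p₄ + 2 * p₄ * p₆ + 2 * p₄ * p₇ + 4 * p₅ * p₅ + 2 * p₅ * p₆ + 4 * p₅ * p₇ + 2 * p₆ * p₄ + 2 * p₆ * p₅ + 4 * p₆ * p₆ + 4 * p₆ * p₇ + 2 * p₇ * p₄ + 4 * p₇ * p₅ + 4 * p₇ * p₆ + 8 * p₇ * p₇ := by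
    apply RingOfIntegers.coe_injective; push_cast; exact hA0
  have hB1 : (4096 : 𝓞 K) * x₁ = p₀ * p₁ + p₁ * p₀ + p₂ * p₂ + 2 * p₂ * p₃ + 2 * p₃ * p₂ + 2 * p₃ * p₃ + 2 * p₄ * p₅ + p₄ * p₆ + 2 * p₄ * p₇ + 2 * p₅ * p₄ + 2 * p₅ * p₆ + 2 * p₅ * p₇ + p₆ * p₄ + 2 * p₆ * p₅ + 2 * p₆ * p₆ + 4 * p₆ * p₇ + 2 * p₇ * p₄ + 2 * p₇ * p₅ + 4 * p₇ * p₆ + 4 * p₇ * p₇ := by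
    apply RingOfIntegers.coe_injective; push_cast; exact hA1
  have hB2 : (4096 : 𝓞 K) * x₂ = p₀ * p₂ + 2 * p₁ * p₃ + p₂ * p₀ + 2 * p₃ * p₁ + p₄ * p₄ + 2 * p₄ * p₆ + 2 * p₅ * p₅ + 4 * p₅ * p₇ + 2 * p₆ * p₄ + 2 * p₆ * p₆ + 2 * p₆ * p₇ + 4 * p₇ * p₅ + 2 * p₇ * p₆ + 4 * p₇ * p₇ := by
    apply RingOfIntegers.coe_injective; push_cast; exact hA2
  have hB3 : (4096 : 𝓞 K) * x₃ = p₀ * p₃ + p₁ * p₂ + p₂ * p₁ + p₃ * p₀ + p₄ * p₅ + 2 * p₄ * p₇ + p₅ * p₄ + 2 * p₅ * p₆ + 2 * p₆ * p₅ + p₆ * p₆ + 2 * p₆ * p₇ + 2 * p₇ * p₄ + 2 * p₇ * p₆ + 2 * p₇ * p₇ := by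
    apply RingOfIntegers.coe_injective; push_cast; exact hA3
  have hB4 : (4096 : 𝓞 K) * x₄ = p₀ * p₄ + 2 * p₁ * p₅ + 2 * p₂ * p₆ + 2 * p₂ * p₇ + 2 * p₃ * p₆ + 4 * p₃ * p₇ + p₄ * p₀ + 2 * p₅ * p₁ + 2 * p₆ * p₂ + 2 * p₆ * p₃ + 2 * p₇ * p₂ + 4 * p₇ * p₃ := by
    apply RingOfIntegers.coe_injective; push_cast; exact hA4
  have hB5 : (4096 : 𝓞 K) * x₅ = p₀ * p₅ + p₁ * p₄ + p₂ * p₆ + 2 * p₂ * p₇ + 2 * p₃ * p₆ + 2 * p₃ * p₇ + p₄ * p₁ + p₅ * p₀ + p₆ * p₂ + 2 * p₆ * p₃ + 2 * p₇ * p₂ + 2 * p₇ * p₃ := by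
    apply RingOfIntegers.coe_injective; push_cast; exact hA5
  have hB6 : (4096 : 𝓞 K) * x₆ = p₀ * p₆ + 2 * p₁ * p₇ + p₂ * p₄ + 2 * p₃ * p₅ + p₄ * p₂ + 2 * p₅ * p₃ + p₆ * p₀ + 2 * p₇ * p₁ := by
    apply RingOfIntegers.coe_injective; push_cast; exact hA6
  have hB7 : (4096 : 𝓞 K) * x₇ = p₀ * p₇ + p₁ * p₆ + p₂ * p₅ + p₃ * p₄ + p₄ * p₃ + p₅ * p₂ + p₆ * p₁ + p₇ * p₀ := by
    apply RingOfIntegers.coe_injective; push_cast; exact hA7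
  have hψ0 := congrArg ψ hB0
  have hψ1 := congrArg ψ hB1
  have hψ2 := congrArg ψ hB2
  have hψ3 := congrArg ψ hB3
  have hψ4 := congrArg ψ hB4
  have hψ5 := congrArg ψ hB5
  have hψ6 := congrArg ψ hB6
  have hψ7 := congrArg ψ hB7
  simp only [map_mul, map_add, map_ofNat] at hψ0 hψ1 hψ2 hψ3 hψ4 hψ5 hψ6 hψ7
  refine ⟨(ψ p₀ + ψ p₁ * r₁ + (ψ p₂ + ψ p₃ * r₁) * r₂ + (ψ p₄ + ψ p₅ * r₁ + (ψ p₆ + ψ p₇ * r₁) * r₂) * r₃) * t ^ 6, ?_⟩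
  have ht12 : (4096 : ZMod q) * t ^ 12 = 1 := by
    linear_combination (2048 * t ^ 11 + 1024 * t ^ 10 + 512 * t ^ 9 + 256 * t ^ 8 + 128 * t ^ 7 + 64 * t ^ 6 + 32 * t ^ 5 +
      16 * t ^ 4 + 8 * t ^ 3 + 4 * t ^ 2 + 2 * t + 1) * ht
  linear_combination (t ^ 12 * (1)) * hψ0 + (t ^ 12 * (r₁)) * hψ1 + (t ^ 12 * (r₂)) * hψ2 + (t ^ 12 * (r₁ * r₂)) * hψ3 + (t ^ 12 * (r₃)) * hψ4 + (t ^ 12 * (r₁ * r₃)) * hψ5 + (t ^ 12 * (r₂ * r₃)) * hψ6 + (t ^ 12 * (r₁ * r₂ * r₃)) * hψ7 +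
    (-(t ^ 12) * (ψ p₁ * ψ p₁ + ψ p₂ * ψ p₃ + ψ p₃ * ψ p₂ + 2 * ψ p₃ * ψ p₃ + ψ p₄ * ψ p₇ + 2 * ψ p₅ * ψ p₅ + ψ p₅ * ψ p₆ + 2 * ψ p₅ * ψ p₇ + ψ p₆ * ψ p₅ + 2 * ψ p₆ * ψ p₇ + ψ p₇ * ψ p₄ + 2 * ψ p₇ * ψ p₅ + 2 * ψ p₇ * ψ p₆ + 4 * ψ p₇ * ψ p₇ + r₁ * ψ p₃ * ψ p₃ + r₁ * ψ p₅ * ψ p₇ + r₁ * ψ p₇ * ψ p₅ + 2 * r₁ * ψ p₇ * ψ p₇ + r₂ * ψ p₁ * ψ p₃ + r₂ * ψ p₃ * ψ p₁ + r₂ * ψ p₅ * ψ p₅ + 2 * r₂ * ψ p₅ * ψ p₇ + r₂ * ψ p₆ * ψ p₇ + 2 * r₂ * ψ p₇ * ψ p₅ + r₂ * ψ p₇ * ψ p₆ + 2 * r₂ * ψ p₇ * ψ p₇ + r₃ * ψ p₁ * ψ p₅ + r₃ * ψ p₂ * ψ p₇ + r₃ * ψ p₃ * ψ p₆ + 2 *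 r₃ * ψ p₃ * ψ p₇ + r₃ * ψ p₅ * ψ p₁ + r₃ * ψ p₆ * ψ p₃ + r₃ * ψ p₇ * ψ p₂ + 2 * r₃ * ψ p₇ * ψ p₃ + r₁ * r₂ * ψ p₇ * ψ p₇ + r₁ * r₃ * ψ p₃ * ψ p₇ + r₁ * r₃ * ψ p₇ * ψ p₃ + r₂ * r₃ * ψ p₁ * ψ p₇ + r₂ * r₃ * ψ p₃ * ψ p₅ + r₂ * r₃ * ψ p₅ * ψ p₃ + r₂ * r₃ * ψ p₇ * ψ p₁)) * hr₁ +
    (-(t ^ 12) * (ψ p₂ * ψ p₂ + ψ p₄ * ψ p₆ + ψ p₆ * ψ p₄ + 2 * ψ p₆ * ψ p₆ + r₁ * ψ p₂ * ψ p₃ + r₁ * ψ p₃ * ψ p₂ + r₁ * ψ p₄ * ψ p₇ + r₁ * ψ p₅ * ψ p₆ + r₁ * ψ p₆ * ψ p₅ + 2 * r₁ * ψ p₆ * ψ p₇ + r₁ * ψ p₇ * ψ p₄ + 2 * r₁ * ψ p₇ * ψ p₆ + r₁ * r₁ * ψ p₃ * ψ p₃ + r₁ * r₁ * ψ p₅ *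 ψ p₇ + r₁ * r₁ * ψ p₇ * ψ p₅ + 2 * r₁ * r₁ * ψ p₇ * ψ p₇ + r₂ * ψ p₆ * ψ p₆ + r₃ * ψ p₂ * ψ p₆ + r₃ * ψ p₆ * ψ p₂ + r₁ * r₂ * ψ p₆ * ψ p₇ + r₁ * r₂ * ψ p₇ * ψ p₆ + r₁ * r₃ * ψ p₂ * ψ p₇ + r₁ * r₃ * ψ p₃ * ψ p₆ + r₁ * r₃ * ψ p₆ * ψ p₃ + r₁ * r₃ * ψ p₇ * ψ p₂ + r₁ * r₁ * r₂ * ψ p₇ * ψ p₇ + r₁ * r₁ * r₃ * ψ p₃ * ψ p₇ + r₁ * r₁ * r₃ * ψ p₇ * ψ p₃)) * hr₂ +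
    (-(t ^ 12) * (ψ p₄ * ψ p₄ + r₁ * ψ p₄ * ψ p₅ + r₁ * ψ p₅ * ψ p₄ + r₁ * r₁ * ψ p₅ * ψ p₅ + r₂ * ψ p₄ * ψ p₆ + r₂ * ψ p₆ * ψ p₄ + r₂ * r₂ * ψ p₆ * ψ p₆ + r₁ * r₂ * ψ p₄ * ψ p₇ + r₁ * r₂ * ψ p₅ * ψ p₆ + r₁ * r₂ * ψ p₆ * ψ p₅ + r₁ * r₂ * ψ p₇ * ψ p₄ + r₁ * r₂ * r₂ * ψ p₆ * ψ p₇ + r₁ * r₂ * r₂ * ψ p₇ * ψ p₆ + r₁ * r₁ * r₂ * ψ p₅ * ψ p₇ + r₁ * r₁ * r₂ * ψ p₇ * ψ p₅ + r₁ * r₁ * r₂ * r₂ * ψ p₇ * ψ p₇)) * hr₃ +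
    (-(ψ x₀ + ψ x₁ * r₁ + (ψ x₂ + ψ x₃ * r₁) * r₂ + (ψ x₄ + ψ x₅ * r₁ + (ψ x₆ + ψ x₇ * r₁) * r₂) * r₃)) * ht12

omit [NumberField K₁] [NumberField K₂] [NumberField L] [Algebra K K₁] [Algebra K K₂] [IsScalarTower K K₁ K₂] [IsScalarTower K K₂ L]
  [FiniteDimensional K K₁] [IsGalois K K₁] [FiniteDimensional K₁ K₂] [IsGalois K₁ K₂] [FiniteDimensional K₂ L] [IsGalois K₂ L] in
/-- **Coordinates of a product, with the symbol** (closure of «has `𝓞_K`-coordinates with symbol `v`» under multiplication; the product rule read through `ψ`).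
[folklore] -/
private theorem exists_coord8_mul_of_coord8 {s₁ : K₁} (hs₁ : s₁ ^ 2 = 2) {s₂ : K₂} (hs₂ : s₂ ^ 2 = algebraMap K₁ K₂ (2 + s₁))
    {s₃ : L} (hs₃ : s₃ ^ 2 = algebraMap K₂ L (2 + s₂)) {q : ℕ} (ψ : 𝓞 K →+* ZMod q) {r₁ r₂ r₃ : ZMod q}
    (hr₁ : r₁ ^ 2 = 2) (hr₂ : r₂ ^ 2 = 2 + r₁) (hr₃ : r₃ ^ 2 = 2 + r₂) {y y' : L} {v v' : ZMod q}
    (hy : ∃ A₀ A₁ A₂ A₃ A₄ A₅ A₆ A₇ : 𝓞 K, y = algebraMap K L (A₀ : K) + algebraMap K L (A₁ : K) * algebraMap K₁ L s₁ + (algebraMap K L (A₂ : K) + algebraMap K L (A₃ : K) * algebraMap K₁ L s₁) * algebraMap K₂ L s₂ + (algebraMap K L (A₄ : K) + algebraMap K L (A₅ : K) * algebraMap K₁ L s₁ + (algebraMap K L (A₆ : K) + algebraMap K L (A₇ : K) * algebraMap K₁ L s₁) * algebraMap K₂ L s₂) * s₃ ∧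
      ψ A₀ + ψ A₁ * r₁ + (ψ A₂ + ψ A₃ * r₁) * r₂ + (ψ A₄ + ψ A₅ * r₁ + (ψ A₆ + ψ A₇ * r₁) * r₂) * r₃ = v)
    (hy' : ∃ C₀ C₁ C₂ C₃ C₄ C₅ C₆ C₇ : 𝓞 K, y' = algebraMap K L (C₀ : K) + algebraMap K L (C₁ : K) * algebraMap K₁ L s₁ + (algebraMap K L (C₂ : K) + algebraMap K L (C₃ : K) * algebraMap K₁ L s₁) * algebraMap K₂ L s₂ + (algebraMap K L (C₄ : K) + algebraMap K L (C₅ : K) * algebraMap K₁ L s₁ + (algebraMap K L (C₆ : K) + algebraMap K L (C₇ : K) * algebraMap K₁ L s₁) * algebraMap K₂ L s₂) * s₃ ∧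
      ψ C₀ + ψ C₁ * r₁ + (ψ C₂ + ψ C₃ * r₁) * r₂ + (ψ C₄ + ψ C₅ * r₁ + (ψ C₆ + ψ C₇ * r₁) * r₂) * r₃ = v') :
    ∃ E₀ E₁ E₂ E₃ E₄ E₅ E₆ E₇ : 𝓞 K, y * y' = algebraMap K L (E₀ : K) + algebraMap K L (E₁ : K) * algebraMap K₁ L s₁ + (algebraMap K L (E₂ : K) + algebraMap K L (E₃ : K) * algebraMap K₁ L s₁) * algebraMap K₂ L s₂ + (algebraMap K L (E₄ : K) + algebraMap K L (E₅ : K) * algebraMap K₁ L s₁ + (algebraMap K L (E₆ : K) + algebraMap K L (E₇ : K) * algebraMap K₁ L s₁) * algebraMap K₂ L s₂) * s₃ ∧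
      ψ E₀ + ψ E₁ * r₁ + (ψ E₂ + ψ E₃ * r₁) * r₂ + (ψ E₄ + ψ E₅ * r₁ + (ψ E₆ + ψ E₇ * r₁) * r₂) * r₃ = v * v' := by
  obtain ⟨A₀, A₁, A₂, A₃, A₄, A₅, A₆, A₇, rfl, rfl⟩ := hy
  obtain ⟨C₀, C₁, C₂, C₃, C₄, C₅, C₆, C₇, rfl, rfl⟩ := hy'
  have hS₁ : (algebraMap K₁ L s₁) ^ 2 = 2 := by rw [← map_pow, hs₁, map_ofNat]
  have hS₂ : (algebraMap K₂ L s₂) ^ 2 = 2 + algebraMap K₁ L s₁ := by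
    rw [← map_pow, hs₂, ← IsScalarTower.algebraMap_apply, map_add, map_ofNat]
  have hS₃ : s₃ ^ 2 = 2 + algebraMap K₂ L s₂ := by rw [hs₃, map_add, map_ofNat]
  refine ⟨A₀ * C₀ + (A₁ * C₁ + A₁ * C₁) + (A₂ * C₂ + A₂ * C₂) + (A₂ * C₃ + A₂ * C₃) + (A₃ * C₂ + A₃ * C₂) + (A₃ * C₃ + A₃ * C₃ + A₃ * C₃ + A₃ * C₃) + (A₄ * C₄ + A₄ * C₄) + (A₄ * C₆ + A₄ * C₆) + (A₄ * C₇ + A₄ * C₇) + (A₅ * C₅ + A₅ * C₅ + A₅ * C₅ + A₅ * C₅) + (A₅ * C₆ + A₅ * C₆) + (A₅ * C₇ + A₅ * C₇ + A₅ * C₇ + A₅ * C₇) + (A₆ * C₄ + A₆ * C₄) + (A₆ * C₅ + A₆ * C₅) + (A₆ * C₆ + A₆ * C₆ + A₆ * C₆ + A₆ * C₆) + (A₆ * C₇ + A₆ * C₇ + A₆ * C₇ + A₆ * C₇) + (A₇ * C₄ + A₇ * C₄) + (A₇ * C₅ + A₇ * C₅ + A₇ * C₅ + A₇ * C₅) +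 (A₇ * C₆ + A₇ * C₆ + A₇ * C₆ + A₇ * C₆) + (A₇ * C₇ + A₇ * C₇ + A₇ * C₇ + A₇ * C₇ + A₇ * C₇ + A₇ * C₇ + A₇ * C₇ + A₇ * C₇), A₀ * C₁ + A₁ * C₀ + A₂ * C₂ + (A₂ * C₃ + A₂ * C₃) + (A₃ * C₂ + A₃ * C₂) + (A₃ * C₃ + A₃ * C₃) + (A₄ * C₅ + A₄ * C₅) + A₄ * C₆ + (A₄ * C₇ + A₄ * C₇) + (A₅ * C₄ + A₅ * C₄) + (A₅ * C₆ + A₅ * C₆) + (A₅ * C₇ + A₅ * C₇) + A₆ * C₄ + (A₆ * C₅ + A₆ * C₅) + (A₆ * C₆ + A₆ * C₆) + (A₆ * C₇ + A₆ * C₇ + A₆ * C₇ + A₆ * C₇) + (A₇ * C₄ + A₇ * C₄) + (A₇ * C₅ + A₇ * C₅) + (A₇ * C₆ + A₇ * C₆ + A₇ * C₆ + A₇ * C₆) + (A₇ * C₇ + A₇ * C₇ + A₇ * C₇ + A₇ * C₇), A₀ * C₂ + (A₁ * C₃ + A₁ * C₃) + A₂ * C₀ + (A₃ * C₁ + A₃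 * C₁) + A₄ * C₄ + (A₄ * C₆ + A₄ * C₆) + (A₅ * C₅ + A₅ * C₅) + (A₅ * C₇ + A₅ * C₇ + A₅ * C₇ + A₅ * C₇) + (A₆ * C₄ + A₆ * C₄) + (A₆ * C₆ + A₆ * C₆) + (A₆ * C₇ + A₆ * C₇) + (A₇ * C₅ + A₇ * C₅ + A₇ * C₅ + A₇ * C₅) + (A₇ * C₆ + A₇ * C₆) + (A₇ * C₇ + A₇ * C₇ + A₇ * C₇ + A₇ * C₇), A₀ * C₃ + A₁ * C₂ + A₂ * C₁ + A₃ * C₀ + A₄ * C₅ + (A₄ * C₇ + A₄ * C₇) + A₅ * C₄ + (A₅ * C₆ + A₅ * C₆) + (A₆ * C₅ + A₆ * C₅) + A₆ * C₆ + (A₆ * C₇ + A₆ * C₇) + (A₇ * C₄ + A₇ * C₄) + (A₇ * C₆ + A₇ * C₆) + (A₇ * C₇ + A₇ * C₇), A₀ * C₄ + (A₁ * C₅ + A₁ * C₅) + (A₂ * C₆ + A₂ * C₆) + (A₂ * C₇ + A₂ * C₇) + (A₃ * C₆ + A₃ * C₆) + (A₃ * C₇ + A₃ * C₇ + A₃ *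 C₇ + A₃ * C₇) + A₄ * C₀ + (A₅ * C₁ + A₅ * C₁) + (A₆ * C₂ + A₆ * C₂) + (A₆ * C₃ + A₆ * C₃) + (A₇ * C₂ + A₇ * C₂) + (A₇ * C₃ + A₇ * C₃ + A₇ * C₃ + A₇ * C₃), A₀ * C₅ + A₁ * C₄ + A₂ * C₆ + (A₂ * C₇ + A₂ * C₇) + (A₃ * C₆ + A₃ * C₆) + (A₃ * C₇ + A₃ * C₇) + A₄ * C₁ + A₅ * C₀ + A₆ * C₂ + (A₆ * C₃ + A₆ * C₃) + (A₇ * C₂ + A₇ * C₂) + (A₇ * C₃ + A₇ * C₃), A₀ * C₆ + (A₁ * C₇ + A₁ * C₇) + A₂ * C₄ + (A₃ * C₅ + A₃ * C₅) + A₄ * C₂ + (A₅ * C₃ + A₅ * C₃) + A₆ * C₀ + (A₇ * C₁ + A₇ * C₁), A₀ * C₇ + A₁ * C₆ + A₂ * C₅ + A₃ * C₄ + A₄ * C₃ + A₅ * C₂ + A₆ * C₁ + A₇ * C₀, ?_, ?_⟩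
  · push_cast
    linear_combination (algebraMap K L (A₁ : K) * algebraMap K L (C₁ : K) + algebraMap K L (A₂ : K) * algebraMap K L (C₃ : K) + algebraMap K L (A₃ : K) * algebraMap K L (C₂ : K) + 2 * algebraMap K L (A₃ : K) * algebraMap K L (C₃ : K) + algebraMap K L (A₄ : K) * algebraMap K L (C₇ : K) + 2 * algebraMap K L (A₅ : K) * algebraMap K L (C₅ : K) + algebraMap K L (A₅ : K) * algebraMap K L (C₆ : K) + 2 * algebraMap K L (A₅ : K) * algebraMap K L (C₇ : K) + algebraMap K L (A₆ : K) * algebraMap K L (C₅ : K) + 2 * algebraMap K L (A₆ : K) * algebraMap K L (C₇ : K) + algebraMap K L (A₇ : K) * algebraMap K L (C₄ : K) + 2 * algebraMap K L (A₇ : K) * algebraMap K L (C₅ : K) + 2 * algebraMap K L (A₇ : K) * algebraMap K L (C₆ : K) + 4 * algebraMap K L (A₇ : K) * algebraMap K L (C₇ : K) + algebraMap K₁ L s₁ * algebraMap K L (A₃ : K) * algebraMap K L (C₃ : K) + algebraMap K₁ L s₁ * algebraMap K L (A₅ : K) * algebraMap K L (C₇ : K) + algebraMap K₁ L s₁ *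 algebraMap K L (A₇ : K) * algebraMap K L (C₅ : K) + 2 * algebraMap K₁ L s₁ * algebraMap K L (A₇ : K) * algebraMap K L (C₇ : K) + algebraMap K₂ L s₂ * algebraMap K L (A₁ : K) * algebraMap K L (C₃ : K) + algebraMap K₂ L s₂ * algebraMap K L (A₃ : K) * algebraMap K L (C₁ : K) + algebraMap K₂ L s₂ * algebraMap K L (A₅ : K) * algebraMap K L (C₅ : K) + 2 * algebraMap K₂ L s₂ * algebraMap K L (A₅ : K) * algebraMap K L (C₇ : K) + algebraMap K₂ L s₂ * algebraMap K L (A₆ : K) * algebraMap K L (C₇ : K) + 2 * algebraMap K₂ L s₂ * algebraMap K L (A₇ : K) * algebraMap K L (C₅ : K) + algebraMap K₂ L s₂ * algebraMap K L (A₇ : K) * algebraMap K L (C₆ : K) + 2 * algebraMap K₂ L s₂ * algebraMap K L (A₇ : K) * algebraMap K L (C₇ : K) + s₃ * algebraMap K L (A₁ : K) * algebraMap K L (C₅ : K) + s₃ * algebraMap K L (A₂ : K) * algebraMap K L (C₇ : K) + s₃ * algebraMap K L (A₃ : K) * algebraMap K L (C₆ : K) + 2 * s₃ * algebraMap K L (A₃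 : K) * algebraMap K L (C₇ : K) + s₃ * algebraMap K L (A₅ : K) * algebraMap K L (C₁ : K) + s₃ * algebraMap K L (A₆ : K) * algebraMap K L (C₃ : K) + s₃ * algebraMap K L (A₇ : K) * algebraMap K L (C₂ : K) + 2 * s₃ * algebraMap K L (A₇ : K) * algebraMap K L (C₃ : K) + algebraMap K₁ L s₁ * algebraMap K₂ L s₂ * algebraMap K L (A₇ : K) * algebraMap K L (C₇ : K) + algebraMap K₁ L s₁ * s₃ * algebraMap K L (A₃ : K) * algebraMap K L (C₇ : K) + algebraMap K₁ L s₁ * s₃ * algebraMap K L (A₇ : K) * algebraMap K L (C₃ : K) + algebraMap K₂ L s₂ * s₃ * algebraMap K L (A₁ : K) * algebraMap K L (C₇ : K) + algebraMap K₂ L s₂ * s₃ * algebraMap K L (A₃ : K) * algebraMap K L (C₅ : K) + algebraMap K₂ L s₂ * s₃ * algebraMap K L (A₅ : K) * algebraMap K L (C₃ : K) + algebraMap K₂ L s₂ * s₃ * algebraMap K L (A₇ : K) * algebraMap K L (C₁ : K)) * hS₁ +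
      (algebraMap K L (A₂ : K) * algebraMap K L (C₂ : K) + algebraMap K L (A₄ : K) * algebraMap K L (C₆ : K) + algebraMap K L (A₆ : K) * algebraMap K L (C₄ : K) + 2 * algebraMap K L (A₆ : K) * algebraMap K L (C₆ : K) + algebraMap K₁ L s₁ * algebraMap K L (A₂ : K) * algebraMap K L (C₃ : K) + algebraMap K₁ L s₁ * algebraMap K L (A₃ : K) * algebraMap K L (C₂ : K) + algebraMap K₁ L s₁ * algebraMap K L (A₄ : K) * algebraMap K L (C₇ : K) + algebraMap K₁ L s₁ * algebraMap K L (A₅ : K) * algebraMap K L (C₆ : K) + algebraMap K₁ L s₁ * algebraMap K L (A₆ : K) * algebraMap K L (C₅ : K) + 2 * algebraMap K₁ L s₁ * algebraMap K L (A₆ : K) * algebraMap K L (C₇ : K) + algebraMap K₁ L s₁ * algebraMap K L (A₇ : K) * algebraMap K L (C₄ : K) + 2 * algebraMap K₁ L s₁ * algebraMap K L (A₇ : K) * algebraMap K L (C₆ : K) + algebraMap K₁ L s₁ * algebraMap K₁ L s₁ * algebraMap K L (A₃ : K) * algebraMap K L (C₃ : K) + algebraMap K₁ L s₁ * algebraMap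 K₁ L s₁ * algebraMap K L (A₅ : K) * algebraMap K L (C₇ : K) + algebraMap K₁ L s₁ * algebraMap K₁ L s₁ * algebraMap K L (A₇ : K) * algebraMap K L (C₅ : K) + 2 * algebraMap K₁ L s₁ * algebraMap K₁ L s₁ * algebraMap K L (A₇ : K) * algebraMap K L (C₇ : K) + algebraMap K₂ L s₂ * algebraMap K L (A₆ : K) * algebraMap K L (C₆ : K) + s₃ * algebraMap K L (A₂ : K) * algebraMap K L (C₆ : K) + s₃ * algebraMap K L (A₆ : K) * algebraMap K L (C₂ : K) + algebraMap K₁ L s₁ * algebraMap K₂ L s₂ * algebraMap K L (A₆ : K) * algebraMap K L (C₇ : K) + algebraMap K₁ L s₁ * algebraMap K₂ L s₂ * algebraMap K L (A₇ : K) * algebraMap K L (C₆ : K) + algebraMap K₁ L s₁ * s₃ * algebraMap K L (A₂ : K) * algebraMap K L (C₇ : K) + algebraMap K₁ L s₁ * s₃ * algebraMap K L (A₃ : K) * algebraMap K L (C₆ : K) + algebraMap K₁ L s₁ * s₃ * algebraMap K L (A₆ : K) * algebraMap K L (C₃ : K) + algebraMap K₁ L s₁ * s₃ * algebraMap K L (A₇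 : K) * algebraMap K L (C₂ : K) + algebraMap K₁ L s₁ * algebraMap K₁ L s₁ * algebraMap K₂ L s₂ * algebraMap K L (A₇ : K) * algebraMap K L (C₇ : K) + algebraMap K₁ L s₁ * algebraMap K₁ L s₁ * s₃ * algebraMap K L (A₃ : K) * algebraMap K L (C₇ : K) + algebraMap K₁ L s₁ * algebraMap K₁ L s₁ * s₃ * algebraMap K L (A₇ : K) * algebraMap K L (C₃ : K)) * hS₂ +
      (algebraMap K L (A₄ : K) * algebraMap K L (C₄ : K) + algebraMap K₁ L s₁ * algebraMap K L (A₄ : K) * algebraMap K L (C₅ : K) + algebraMap K₁ L s₁ * algebraMap K L (A₅ : K) * algebraMap K L (C₄ : K) + algebraMap K₁ L s₁ * algebraMap K₁ L s₁ * algebraMap K L (A₅ : K) * algebraMap K L (C₅ : K) + algebraMap K₂ L s₂ * algebraMap K L (A₄ : K) * algebraMap K L (C₆ : K) + algebraMap K₂ L s₂ * algebraMap K L (A₆ : K) * algebraMap K L (C₄ : K) + algebraMap K₂ L s₂ * algebraMap K₂ L s₂ * algebraMap K L (A₆ : K) * algebraMap K L (C₆ : K) + algebraMap K₁ L s₁ *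 algebraMap K₂ L s₂ * algebraMap K L (A₄ : K) * algebraMap K L (C₇ : K) + algebraMap K₁ L s₁ * algebraMap K₂ L s₂ * algebraMap K L (A₅ : K) * algebraMap K L (C₆ : K) + algebraMap K₁ L s₁ * algebraMap K₂ L s₂ * algebraMap K L (A₆ : K) * algebraMap K L (C₅ : K) + algebraMap K₁ L s₁ * algebraMap K₂ L s₂ * algebraMap K L (A₇ : K) * algebraMap K L (C₄ : K) + algebraMap K₁ L s₁ * algebraMap K₂ L s₂ * algebraMap K₂ L s₂ * algebraMap K L (A₆ : K) * algebraMap K L (C₇ : K) + algebraMap K₁ L s₁ * algebraMap K₂ L s₂ * algebraMap K₂ L s₂ * algebraMap K L (A₇ : K) * algebraMap K L (C₆ : K) + algebraMap K₁ L s₁ * algebraMap K₁ L s₁ * algebraMap K₂ L s₂ * algebraMap K L (A₅ : K) * algebraMap K L (C₇ : K) + algebraMap K₁ L s₁ * algebraMap K₁ L s₁ * algebraMap K₂ L s₂ * algebraMap K L (A₇ : K) * algebraMap K L (C₅ : K) + algebraMap K₁ L s₁ * algebraMap K₁ L s₁ * algebraMap K₂ L s₂ * algebraMap K₂ L s₂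 * algebraMap K L (A₇ : K) * algebraMap K L (C₇ : K)) * hS₃
  · simp only [map_add, map_mul]
    linear_combination (-(ψ A₁ * ψ C₁ + ψ A₂ * ψ C₃ + ψ A₃ * ψ C₂ + 2 * ψ A₃ * ψ C₃ + ψ A₄ * ψ C₇ + 2 * ψ A₅ * ψ C₅ + ψ A₅ * ψ C₆ + 2 * ψ A₅ * ψ C₇ + ψ A₆ * ψ C₅ + 2 * ψ A₆ * ψ C₇ + ψ A₇ * ψ C₄ + 2 * ψ A₇ * ψ C₅ + 2 * ψ A₇ * ψ C₆ + 4 * ψ A₇ * ψ C₇ + r₁ * ψ A₃ * ψ C₃ + r₁ * ψ A₅ * ψ C₇ + r₁ * ψ A₇ * ψ C₅ + 2 * r₁ * ψ A₇ * ψ C₇ + r₂ * ψ A₁ * ψ C₃ + r₂ * ψ A₃ * ψ C₁ + r₂ * ψ A₅ * ψ C₅ + 2 * r₂ * ψ A₅ * ψ C₇ + r₂ * ψ A₆ * ψ C₇ + 2 * r₂ * ψ A₇ * ψ C₅ + r₂ * ψ A₇ * ψ C₆ + 2 * r₂ * ψ A₇ * ψ C₇ + r₃ * ψ A₁ * ψ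 C₅ + r₃ * ψ A₂ * ψ C₇ + r₃ * ψ A₃ * ψ C₆ + 2 * r₃ * ψ A₃ * ψ C₇ + r₃ * ψ A₅ * ψ C₁ + r₃ * ψ A₆ * ψ C₃ + r₃ * ψ A₇ * ψ C₂ + 2 * r₃ * ψ A₇ * ψ C₃ + r₁ * r₂ * ψ A₇ * ψ C₇ + r₁ * r₃ * ψ A₃ * ψ C₇ + r₁ * r₃ * ψ A₇ * ψ C₃ + r₂ * r₃ * ψ A₁ * ψ C₇ + r₂ * r₃ * ψ A₃ * ψ C₅ + r₂ * r₃ * ψ A₅ * ψ C₃ + r₂ * r₃ * ψ A₇ * ψ C₁)) * hr₁ + (-(ψ A₂ * ψ C₂ + ψ A₄ * ψ C₆ + ψ A₆ * ψ C₄ + 2 * ψ A₆ * ψ C₆ + r₁ * ψ A₂ * ψ C₃ + r₁ * ψ A₃ * ψ C₂ + r₁ * ψ A₄ * ψ C₇ + r₁ * ψ A₅ * ψ C₆ + r₁ * ψ A₆ * ψ C₅ + 2 * r₁ * ψ A₆ * ψ C₇ + r₁ * ψ A₇ * ψ C₄ + 2 * r₁ * ψ A₇ * ψ C₆ + r₁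 * r₁ * ψ A₃ * ψ C₃ + r₁ * r₁ * ψ A₅ * ψ C₇ + r₁ * r₁ * ψ A₇ * ψ C₅ + 2 * r₁ * r₁ * ψ A₇ * ψ C₇ + r₂ * ψ A₆ * ψ C₆ + r₃ * ψ A₂ * ψ C₆ + r₃ * ψ A₆ * ψ C₂ + r₁ * r₂ * ψ A₆ * ψ C₇ + r₁ * r₂ * ψ A₇ * ψ C₆ + r₁ * r₃ * ψ A₂ * ψ C₇ + r₁ * r₃ * ψ A₃ * ψ C₆ + r₁ * r₃ * ψ A₆ * ψ C₃ + r₁ * r₃ * ψ A₇ * ψ C₂ + r₁ * r₁ * r₂ * ψ A₇ * ψ C₇ + r₁ * r₁ * r₃ * ψ A₃ * ψ C₇ + r₁ * r₁ * r₃ * ψ A₇ * ψ C₃)) * hr₂ + (-(ψ A₄ * ψ C₄ + r₁ * ψ A₄ * ψ C₅ + r₁ * ψ A₅ * ψ C₄ + r₁ * r₁ * ψ A₅ * ψ C₅ + r₂ * ψ A₄ * ψ C₆ + r₂ * ψ A₆ * ψ C₄ + r₂ * r₂ * ψ A₆ * ψ C₆ + r₁ * r₂ * ψ A₄ * ψ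 C₇ + r₁ * r₂ * ψ A₅ * ψ C₆ + r₁ * r₂ * ψ A₆ * ψ C₅ + r₁ * r₂ * ψ A₇ * ψ C₄ + r₁ * r₂ * r₂ * ψ A₆ * ψ C₇ + r₁ * r₂ * r₂ * ψ A₇ * ψ C₆ + r₁ * r₁ * r₂ * ψ A₅ * ψ C₇ + r₁ * r₁ * r₂ * ψ A₇ * ψ C₅ + r₁ * r₁ * r₂ * r₂ * ψ A₇ * ψ C₇)) * hr₃

omit [NumberField K₁] [NumberField K₂] [NumberField L] [Algebra K K₁] [Algebra K K₂] [IsScalarTower K K₁ K₂] [IsScalarTower K K₂ L]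
  [FiniteDimensional K K₁] [IsGalois K K₁] [FiniteDimensional K₁ K₂] [IsGalois K₁ K₂] [FiniteDimensional K₂ L] [IsGalois K₂ L] in
/-- **Coordinates of a power, with the symbol.** [folklore] -/
private theorem exists_coord8_pow_of_coord8 {s₁ : K₁} (hs₁ : s₁ ^ 2 = 2) {s₂ : K₂} (hs₂ : s₂ ^ 2 = algebraMap K₁ K₂ (2 + s₁))
    {s₃ : L} (hs₃ : s₃ ^ 2 = algebraMap K₂ L (2 + s₂)) {q : ℕ} (ψ : 𝓞 K →+* ZMod q) {r₁ r₂ r₃ : ZMod q}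
    (hr₁ : r₁ ^ 2 = 2) (hr₂ : r₂ ^ 2 = 2 + r₁) (hr₃ : r₃ ^ 2 = 2 + r₂) {y : L} {v : ZMod q}
    (hy : ∃ A₀ A₁ A₂ A₃ A₄ A₅ A₆ A₇ : 𝓞 K, y = algebraMap K L (A₀ : K) + algebraMap K L (A₁ : K) * algebraMap K₁ L s₁ + (algebraMap K L (A₂ : K) + algebraMap K L (A₃ : K) * algebraMap K₁ L s₁) * algebraMap K₂ L s₂ + (algebraMap K L (A₄ : K) + algebraMap K L (A₅ : K) * algebraMap K₁ L s₁ + (algebraMap K L (A₆ : K) + algebraMap K L (A₇ : K) * algebraMap K₁ L s₁) * algebraMap K₂ L s₂) * s₃ ∧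
      ψ A₀ + ψ A₁ * r₁ + (ψ A₂ + ψ A₃ * r₁) * r₂ + (ψ A₄ + ψ A₅ * r₁ + (ψ A₆ + ψ A₇ * r₁) * r₂) * r₃ = v) (k : ℕ) :
    ∃ E₀ E₁ E₂ E₃ E₄ E₅ E₆ E₇ : 𝓞 K, y ^ k = algebraMap K L (E₀ : K) + algebraMap K L (E₁ : K) * algebraMap K₁ L s₁ + (algebraMap K L (E₂ : K) + algebraMap K L (E₃ : K) * algebraMap K₁ L s₁) * algebraMap K₂ L s₂ + (algebraMap K L (E₄ : K) + algebraMap K L (E₅ : K) * algebraMap K₁ L s₁ + (algebraMap K L (E₆ : K) + algebraMap K L (E₇ : K) * algebraMap K₁ L s₁) * algebraMap K₂ L s₂) * s₃ ∧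
      ψ E₀ + ψ E₁ * r₁ + (ψ E₂ + ψ E₃ * r₁) * r₂ + (ψ E₄ + ψ E₅ * r₁ + (ψ E₆ + ψ E₇ * r₁) * r₂) * r₃ = v ^ k := by
  induction k with
  | zero => exact ⟨1, 0, 0, 0, 0, 0, 0, 0, by simp, by simp⟩
  | succ k ih =>
    obtain ⟨E₀, E₁, E₂, E₃, E₄, E₅, E₆, E₇, hE, hv⟩ := exists_coord8_mul_of_coord8 hs₁ hs₂ hs₃ ψ hr₁ hr₂ hr₃ ih hy
    exact ⟨E₀, E₁, E₂, E₃, E₄, E₅, E₆, E₇, by rw [pow_succ, hE], by rw [pow_succ, hv]⟩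

omit [NumberField K₁] [NumberField K₂] [NumberField L] [Algebra K K₁] [Algebra K K₂] [IsScalarTower K K₁ K₂] [IsScalarTower K K₂ L]
  [FiniteDimensional K K₁] [IsGalois K K₁] [FiniteDimensional K₁ K₂] [IsGalois K₁ K₂] [FiniteDimensional K₂ L] [IsGalois K₂ L] in
/-- **Coordinates of a finite product of powers, with the symbol.** [folklore] -/
private theorem exists_coord8_prod_of_coord8 {s₁ : K₁} (hs₁ : s₁ ^ 2 = 2) {s₂ : K₂} (hs₂ : s₂ ^ 2 = algebraMap K₁ K₂ (2 + s₁))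
    {s₃ : L} (hs₃ : s₃ ^ 2 = algebraMap K₂ L (2 + s₂)) {q : ℕ} (ψ : 𝓞 K →+* ZMod q) {r₁ r₂ r₃ : ZMod q}
    (hr₁ : r₁ ^ 2 = 2) (hr₂ : r₂ ^ 2 = 2 + r₁) (hr₃ : r₃ ^ 2 = 2 + r₂) {n : ℕ} (x : Fin n → L) (v : Fin n → ZMod q)
    (hx : ∀ i, ∃ A₀ A₁ A₂ A₃ A₄ A₅ A₆ A₇ : 𝓞 K, x i = algebraMap K L (A₀ : K) + algebraMap K L (A₁ : K) * algebraMap K₁ L s₁ + (algebraMap K L (A₂ : K) + algebraMap K L (A₃ : K) * algebraMap K₁ L s₁) * algebraMap K₂ L s₂ + (algebraMap K L (A₄ : K) + algebraMap K L (A₅ : K) * algebraMap K₁ L s₁ + (algebraMap K L (A₆ : K) + algebraMap K L (A₇ : K) * algebraMap K₁ L s₁) * algebraMap K₂ L s₂) * s₃ ∧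
      ψ A₀ + ψ A₁ * r₁ + (ψ A₂ + ψ A₃ * r₁) * r₂ + (ψ A₄ + ψ A₅ * r₁ + (ψ A₆ + ψ A₇ * r₁) * r₂) * r₃ = v i) (e : Fin n → ℕ) :
    ∃ E₀ E₁ E₂ E₃ E₄ E₅ E₆ E₇ : 𝓞 K, ∏ i, x i ^ e i = algebraMap K L (E₀ : K) + algebraMap K L (E₁ : K) * algebraMap K₁ L s₁ + (algebraMap K L (E₂ : K) + algebraMap K L (E₃ : K) * algebraMap K₁ L s₁) * algebraMap K₂ L s₂ + (algebraMap K L (E₄ : K) + algebraMap K L (E₅ : K) * algebraMap K₁ L s₁ + (algebraMap K L (E₆ : K) + algebraMap K L (E₇ : K) * algebraMap K₁ L s₁) * algebraMap K₂ L s₂) * s₃ ∧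
      ψ E₀ + ψ E₁ * r₁ + (ψ E₂ + ψ E₃ * r₁) * r₂ + (ψ E₄ + ψ E₅ * r₁ + (ψ E₆ + ψ E₇ * r₁) * r₂) * r₃ = ∏ i, v i ^ e i := by
  induction n with
  | zero => exact ⟨1, 0, 0, 0, 0, 0, 0, 0, by simp, by simp⟩
  | succ n ih =>
    obtain ⟨E₀, E₁, E₂, E₃, E₄, E₅, E₆, E₇, hE, hv⟩ := ih (fun i => x i.succ) (fun i => v i.succ) (fun i => hx i.succ) (fun i => e i.succ)
    obtain ⟨F₀, F₁, F₂, F₃, F₄, F₅, F₆, F₇, hF, hw⟩ := exists_coord8_mul_of_coord8 hs₁ hs₂ hs₃ ψ hr₁ hr₂ hr₃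
      (exists_coord8_pow_of_coord8 hs₁ hs₂ hs₃ ψ hr₁ hr₂ hr₃ (hx 0) (e 0)) ⟨E₀, E₁, E₂, E₃, E₄, E₅, E₆, E₇, hE, hv⟩
    refine ⟨F₀, F₁, F₂, F₃, F₄, F₅, F₆, F₇, ?_, ?_⟩
    · rw [Fin.prod_univ_succ, hF]
    · rw [Fin.prod_univ_succ, hw]

/-- ★ **The obstruction for a signed product `±∏ u_i^{e_i} · w^{e'}` of coordinate elements** in the three-step tower. [cite: NeukirchANT1999, Ch. I §8]
[cite: Marcus2018, Ch. 3, Thm. 27] -/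
theorem isSquare_residue8_of_sq_eq_prod (h1 : Module.finrank K K₁ = 2) (h2 : Module.finrank K₁ K₂ = 2) (h3 : Module.finrank K₂ L = 2)
    {s₁ : K₁} (hs₁ : s₁ ^ 2 = 2) (hs₁K : ∀ k : K, algebraMap K K₁ k ≠ s₁)
    {s₂ : K₂} (hs₂ : s₂ ^ 2 = algebraMap K₁ K₂ (2 + s₁)) (hs₂K : ∀ x : K₁, algebraMap K₁ K₂ x ≠ s₂)
    {s₃ : L} (hs₃ : s₃ ^ 2 = algebraMap K₂ L (2 + s₂)) (hs₃K : ∀ x : K₂, algebraMap K₂ L x ≠ s₃)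
    {q : ℕ} (ψ : 𝓞 K →+* ZMod q) {t r₁ r₂ r₃ : ZMod q} (ht : 2 * t = 1) (hr₁ : r₁ ^ 2 = 2) (hr₂ : r₂ ^ 2 = 2 + r₁) (hr₃ : r₃ ^ 2 = 2 + r₂)
    {n : ℕ} {x : Fin n → L} (a₀ a₁ a₂ a₃ a₄ a₅ a₆ a₇ : Fin n → 𝓞 K) {y : L} (A₀ A₁ A₂ A₃ A₄ A₅ A₆ A₇ : 𝓞 K)
    (hx : ∀ i, x i = algebraMap K L (a₀ i : K) + algebraMap K L (a₁ i : K) * algebraMap K₁ L s₁ + (algebraMap K L (a₂ i : K) + algebraMap K L (a₃ i : K) * algebraMap K₁ L s₁) * algebraMap K₂ L s₂ + (algebraMap K L (a₄ i : K) + algebraMap K L (a₅ i : K) * algebraMap K₁ L s₁ + (algebraMap K L (a₆ i : K) + algebraMap K L (a₇ i : K) * algebraMap K₁ L s₁) * algebraMap K₂ L s₂) * s₃)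
    (hy : y = algebraMap K L (A₀ : K) + algebraMap K L (A₁ : K) * algebraMap K₁ L s₁ + (algebraMap K L (A₂ : K) + algebraMap K L (A₃ : K) * algebraMap K₁ L s₁) * algebraMap K₂ L s₂ + (algebraMap K L (A₄ : K) + algebraMap K L (A₅ : K) * algebraMap K₁ L s₁ + (algebraMap K L (A₆ : K) + algebraMap K L (A₇ : K) * algebraMap K₁ L s₁) * algebraMap K₂ L s₂) * s₃)
    (e : Fin n → ℕ) (e' : ℕ) (σ : ℤˣ) {z : L}
    (hz : z ^ 2 = ((σ : ℤ) : L) * (∏ i, x i ^ e i) * y ^ e') :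
    IsSquare (((σ : ℤ) : ZMod q) * (∏ i, (ψ (a₀ i) + ψ (a₁ i) * r₁ + (ψ (a₂ i) + ψ (a₃ i) * r₁) * r₂ + (ψ (a₄ i) + ψ (a₅ i) * r₁ + (ψ (a₆ i) + ψ (a₇ i) * r₁) * r₂) * r₃) ^ e i) *
      (ψ A₀ + ψ A₁ * r₁ + (ψ A₂ + ψ A₃ * r₁) * r₂ + (ψ A₄ + ψ A₅ * r₁ + (ψ A₆ + ψ A₇ * r₁) * r₂) * r₃) ^ e') := by
  have hσ : ∃ T₀ T₁ T₂ T₃ T₄ T₅ T₆ T₇ : 𝓞 K, ((σ : ℤ) : L) = algebraMap K L (T₀ : K) + algebraMap K L (T₁ : K) * algebraMap K₁ L s₁ + (algebraMap K L (T₂ : K) + algebraMap K L (T₃ : K) * algebraMap K₁ L s₁) * algebraMap K₂ L s₂ + (algebraMap K L (T₄ : K) + algebraMap K L (T₅ : K) * algebraMap K₁ L s₁ + (algebraMap K L (T₆ : K) + algebraMap K L (T₇ : K) * algebraMap K₁ L s₁) * algebraMap K₂ L s₂) * s₃ ∧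
      ψ T₀ + ψ T₁ * r₁ + (ψ T₂ + ψ T₃ * r₁) * r₂ + (ψ T₄ + ψ T₅ * r₁ + (ψ T₆ + ψ T₇ * r₁) * r₂) * r₃ = ((σ : ℤ) : ZMod q) := by
    refine ⟨(σ : ℤ), 0, 0, 0, 0, 0, 0, 0, ?_, ?_⟩
    · push_cast; simp
    · simp
  have hP := exists_coord8_prod_of_coord8 hs₁ hs₂ hs₃ ψ hr₁ hr₂ hr₃ x
    (fun i => ψ (a₀ i) + ψ (a₁ i) * r₁ + (ψ (a₂ i) + ψ (a₃ i) * r₁) * r₂ + (ψ (a₄ i) + ψ (a₅ i) * r₁ + (ψ (a₆ i) + ψ (a₇ i) * r₁) * r₂) * r₃)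
    (fun i => ⟨a₀ i, a₁ i, a₂ i, a₃ i, a₄ i, a₅ i, a₆ i, a₇ i, hx i, rfl⟩) e
  have hY := exists_coord8_pow_of_coord8 hs₁ hs₂ hs₃ ψ hr₁ hr₂ hr₃ ⟨A₀, A₁, A₂, A₃, A₄, A₅, A₆, A₇, hy, rfl⟩ e'
  obtain ⟨E₀, E₁, E₂, E₃, E₄, E₅, E₆, E₇, hE, hv⟩ := exists_coord8_mul_of_coord8 hs₁ hs₂ hs₃ ψ hr₁ hr₂ hr₃
    (exists_coord8_mul_of_coord8 hs₁ hs₂ hs₃ ψ hr₁ hr₂ hr₃ hσ hP) hY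
  rw [← hv]
  exact isSquare_residue8_of_sq_eq_coord h1 h2 h3 hs₁ hs₁K hs₂ hs₂K hs₃ hs₃K ψ ht hr₁ hr₂ hr₃ (z := z) (by rw [hz, hE])

end Residue3

/-! ## §3 The order-four certificate in the three-step tower -/

section Main3

variable {K K₁ K₂ L : Type*} [Field K] [Field K₁] [NumberField K₁] [Field K₂] [NumberField K₂] [Field L] [NumberField L]
  [Algebra K K₁] [Algebra K₁ K₂] [Algebra K K₂] [IsScalarTower K K₁ K₂]
  [Algebra K₂ L] [Algebra K L] [Algebra K₁ L] [IsScalarTower K K₂ L] [IsScalarTower K₁ K₂ L]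
  [FiniteDimensional K K₁] [IsGalois K K₁] [FiniteDimensional K₁ K₂] [IsGalois K₁ K₂] [FiniteDimensional K₂ L] [IsGalois K₂ L]

/-- ★★ **THE ORDER-FOUR CERTIFICATE IN THE THREE-STEP TOWER: a class of order `4` in `Cl(L)`.**  Tower `K ⊂ K₁ ⊂ K₂ ⊂ L` of quadratic Galois steps with
`s₁² = 2`, `s₂² = 2 + s₁`, `s₃² = 2 + s₂` (each `s_i` outside the previous field); `L` has a real place and `rank E_L < n + 1`.  DATA: units `u_i` (`i < n`) of `𝓞_L` and
`w` with `𝓞_K`-coordinates on the eight basis monomials; `b ≠ 0`, `v` with `(b, v)² = (w, b²)`, `(w, b²)² = (w)`; and for every `(e, e', ±) ≠ (0, 0, +)` a residue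
certificate `(ψ, t, r₁, r₂, r₃)` at which `±∏ sym(u_i)^{e_i}·sym(w)^{e'}` is NOT a square.  THEN `Cl(L)` has a class of ORDER `4` (that of `(b, v)`).  Proof identical to
the two-step theorem `exists_orderOf_eq_four_of_towerOrderFourCert`. [cite: NeukirchANT1999, Ch. I §7 Thm. (7.4), Ch. I §3, Ch. I §8]
[cite: Cohen1993, §6.5 (verification of class group and unit computations)] [cite: Marcus2018, Ch. 5] -/
theorem exists_orderOf_eq_four_of_tower3OrderFourCert (h1 : Module.finrank K K₁ = 2) (h2 : Module.finrank K₁ K₂ = 2) (h3 : Module.finrank K₂ L = 2)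
    {s₁ : K₁} (hs₁ : s₁ ^ 2 = 2) (hs₁K : ∀ k : K, algebraMap K K₁ k ≠ s₁)
    {s₂ : K₂} (hs₂ : s₂ ^ 2 = algebraMap K₁ K₂ (2 + s₁)) (hs₂K : ∀ x : K₁, algebraMap K₁ K₂ x ≠ s₂)
    {s₃ : L} (hs₃ : s₃ ^ 2 = algebraMap K₂ L (2 + s₂)) (hs₃K : ∀ x : K₂, algebraMap K₂ L x ≠ s₃)
    (hreal : 0 < NumberField.InfinitePlace.nrRealPlaces L) {n : ℕ} (hrank : rank L < n + 1)
    (u : Fin n → (𝓞 L)ˣ) (a₀ a₁ a₂ a₃ a₄ a₅ a₆ a₇ : Fin n → 𝓞 K) {A₀ A₁ A₂ A₃ A₄ A₅ A₆ A₇ : 𝓞 K} {w b v : 𝓞 L}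
    (hu : ∀ i, (((u i : 𝓞 L)) : L) = algebraMap K L (a₀ i : K) + algebraMap K L (a₁ i : K) * algebraMap K₁ L s₁ + (algebraMap K L (a₂ i : K) + algebraMap K L (a₃ i : K) * algebraMap K₁ L s₁) * algebraMap K₂ L s₂ + (algebraMap K L (a₄ i : K) + algebraMap K L (a₅ i : K) * algebraMap K₁ L s₁ + (algebraMap K L (a₆ i : K) + algebraMap K L (a₇ i : K) * algebraMap K₁ L s₁) * algebraMap K₂ L s₂) * s₃)
    (hw : ((w : 𝓞 L) : L) = algebraMap K L (A₀ : K) + algebraMap K L (A₁ : K) * algebraMap K₁ L s₁ + (algebraMap K L (A₂ : K) + algebraMap K L (A₃ : K) * algebraMap K₁ L s₁) * algebraMap K₂ L s₂ + (algebraMap K L (A₄ : K) + algebraMap K L (A₅ : K) * algebraMap K₁ L s₁ + (algebraMap K L (A₆ : K) + algebraMap K L (A₇ : K) * algebraMap K₁ L s₁) * algebraMap K₂ L s₂) * s₃)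
    (hb : b ≠ 0)
    (hI2 : (Ideal.span {b, v}) ^ 2 = Ideal.span {w, b ^ 2}) (hI4 : (Ideal.span {w, b ^ 2}) ^ 2 = Ideal.span {w})
    (hcert : ∀ (e : Fin n → ℕ) (e' : ℕ) (σ : ℤˣ), (∀ i, e i ≤ 1) → e' ≤ 1 → ¬ (e = 0 ∧ e' = 0 ∧ σ = 1) →
      ∃ (q : ℕ) (ψ : 𝓞 K →+* ZMod q) (t r₁ r₂ r₃ : ZMod q), 2 * t = 1 ∧ r₁ ^ 2 = 2 ∧ r₂ ^ 2 = 2 + r₁ ∧ r₃ ^ 2 = 2 + r₂ ∧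
        ¬ IsSquare (((σ : ℤ) : ZMod q) *
          (∏ i, (ψ (a₀ i) + ψ (a₁ i) * r₁ + (ψ (a₂ i) + ψ (a₃ i) * r₁) * r₂ + (ψ (a₄ i) + ψ (a₅ i) * r₁ + (ψ (a₆ i) + ψ (a₇ i) * r₁) * r₂) * r₃) ^ e i) *
          (ψ A₀ + ψ A₁ * r₁ + (ψ A₂ + ψ A₃ * r₁) * r₂ + (ψ A₄ + ψ A₅ * r₁ + (ψ A₆ + ψ A₇ * r₁) * r₂) * r₃) ^ e')) :
    ∃ c : ClassGroup (𝓞 L), orderOf c = 4 := by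
  classical
  haveI : Fact (Nat.Prime 2) := ⟨Nat.prime_two⟩
  obtain ⟨⟨w₀, hw₀⟩⟩ := Fintype.card_pos_iff.mp hreal
  have φ : L →+* ℝ := NumberField.InfinitePlace.embedding_of_isReal hw₀
  have hi : ∀ z : L, z ^ 2 ≠ -1 := sq_ne_neg_one_of_ringHom_real' φ
  -- no `±∏ u_i^{e_i} w^{e'}` with `(e, e', ±) ≠ 0` is a square in `L`
  have hnsq : ∀ (e : Fin n → ℕ) (e' : ℕ) (σ : ℤˣ), (∀ i, e i ≤ 1) → e' ≤ 1 → ¬ (e = 0 ∧ e' = 0 ∧ σ = 1) →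
      ∀ z : L, z ^ 2 ≠ ((σ : ℤ) : L) * (∏ i, (((u i : 𝓞 L)) : L) ^ e i) * ((w : 𝓞 L) : L) ^ e' := by
    intro e e' σ he he' hne z hz
    obtain ⟨q, ψ, t, r₁, r₂, r₃, ht, hr₁, hr₂, hr₃, hns⟩ := hcert e e' σ he he' hne
    exact hns (isSquare_residue8_of_sq_eq_prod h1 h2 h3 hs₁ hs₁K hs₂ hs₂K hs₃ hs₃K ψ ht hr₁ hr₂ hr₃
      a₀ a₁ a₂ a₃ a₄ a₅ a₆ a₇ A₀ A₁ A₂ A₃ A₄ A₅ A₆ A₇ hu hw e e' σ hz)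
  -- `𝔍 = (w, b²)` is not principal
  have hJ : ¬ (Ideal.span {w, b ^ 2}).IsPrincipal := by
    rintro ⟨y, hy⟩
    rw [Ideal.submodule_span_eq] at hy
    have hy2 : Ideal.span {y ^ 2} = Ideal.span {w} := by rw [← Ideal.span_singleton_pow, ← hy, hI4]
    obtain ⟨uw, huw⟩ := Ideal.span_singleton_eq_span_singleton.mp hy2
    obtain ⟨e, he1, he0, g, hg⟩ := exists_prod_pow_eq_sq_of_rank_lt hi hrank (Fin.cons uw u)
    rw [Fin.prod_univ_succ] at hg
    simp only [Fin.cons_zero, Fin.cons_succ] at hg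
    have hsq : ∃ (σ : ℤˣ) (g' : L),
        g' ^ 2 = ((σ : ℤ) : L) * (∏ i, (((u i : 𝓞 L)) : L) ^ e i.succ) * ((w : 𝓞 L) : L) ^ e 0 := by
      have hwe : ((uw : 𝓞 L)) ^ e 0 * (y ^ e 0) ^ 2 = w ^ e 0 := by
        rw [← huw]; ring
      have hwe' := congrArg (fun x : 𝓞 L => (x : L)) hwe
      push_cast at hwe'
      rcases hg with hg | hg
      · refine ⟨1, (((g : 𝓞 L)) : L) * ((y : 𝓞 L) : L) ^ e 0, ?_⟩
        have hg' := congrArg (fun x : (𝓞 L)ˣ => (((x : 𝓞 L)) : L)) hg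
        simp only [Units.val_mul, Units.val_pow_eq_pow_val] at hg'
        push_cast at hg' ⊢
        rw [← hwe']
        linear_combination (-(((y : 𝓞 L) : L) ^ e 0) ^ 2) * hg'
      · refine ⟨-1, (((g : 𝓞 L)) : L) * ((y : 𝓞 L) : L) ^ e 0, ?_⟩
        have hg' := congrArg (fun x : (𝓞 L)ˣ => (((x : 𝓞 L)) : L)) hg
        simp only [Units.val_mul, Units.val_pow_eq_pow_val, Units.val_neg] at hg'
        push_cast at hg' ⊢
        rw [← hwe']
        linear_combination ((((y : 𝓞 L) : L) ^ e 0) ^ 2) * hg'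
    obtain ⟨σ, g', hg'⟩ := hsq
    refine hnsq (fun i => e i.succ) (e 0) σ (fun i => he1 i.succ) (he1 0) ?_ g' hg'
    rintro ⟨hsucc, h0, -⟩
    apply he0
    ext i
    refine Fin.cases ?_ (fun j => ?_) i
    · exact h0
    · exact congrFun hsucc j
  -- the class of `𝔅 = (b, v)` has order `4`
  set I : Ideal (𝓞 L) := Ideal.span {b, v} with hI
  have hI0 : I ≠ ⊥ := fun h => hb (by
    have : b ∈ I := Ideal.subset_span (by simp)
    rw [h, Submodule.mem_bot] at this; exact this)
  have hImem : I ∈ (Ideal (𝓞 L))⁰ := mem_nonZeroDivisors_iff_ne_zero.mpr hI0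
  refine ⟨ClassGroup.mk0 ⟨I, hImem⟩, ?_⟩
  set c := ClassGroup.mk0 ⟨I, hImem⟩ with hc
  have hJmem : Ideal.span {w, b ^ 2} ∈ (Ideal (𝓞 L))⁰ := by
    rw [← hI2]; exact pow_mem hImem 2
  have hc2 : c ^ 2 = ClassGroup.mk0 ⟨Ideal.span {w, b ^ 2}, hJmem⟩ := by
    rw [hc, ← map_pow]; congr 1; exact Subtype.ext (by simp [hI2])
  have hc2ne : c ^ 2 ≠ 1 := by
    rw [hc2, Ne, ClassGroup.mk0_eq_one_iff]; exact hJ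
  have hwmem : Ideal.span {w} ∈ (Ideal (𝓞 L))⁰ := by
    rw [← hI4]; exact pow_mem hJmem 2
  have hc4 : c ^ 4 = 1 := by
    have : c ^ 4 = (c ^ 2) ^ 2 := by rw [← pow_mul]
    rw [this, hc2, ← map_pow]
    have heq : (⟨Ideal.span {w, b ^ 2}, hJmem⟩ : (Ideal (𝓞 L))⁰) ^ 2 = ⟨Ideal.span {w}, hwmem⟩ :=
      Subtype.ext (by simp [hI4])
    rw [heq, ClassGroup.mk0_eq_one_iff]
    exact ⟨⟨w, by rw [Ideal.submodule_span_eq]⟩⟩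
  have := orderOf_eq_prime_pow (p := 2) (n := 1) (x := c) (by rw [pow_one]; exact hc2ne) (by norm_num; exact hc4)
  rw [this]; norm_num

/-- ★★ **`4 ∣ h_L`** under the three-step tower order-four certificate. [cite: NeukirchANT1999, Ch. I §7 Thm. (7.4), Ch. I §3] -/
theorem four_dvd_card_classGroup_of_tower3OrderFourCert (h1 : Module.finrank K K₁ = 2) (h2 : Module.finrank K₁ K₂ = 2)
    (h3 : Module.finrank K₂ L = 2)
    {s₁ : K₁} (hs₁ : s₁ ^ 2 = 2) (hs₁K : ∀ k : K, algebraMap K K₁ k ≠ s₁)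
    {s₂ : K₂} (hs₂ : s₂ ^ 2 = algebraMap K₁ K₂ (2 + s₁)) (hs₂K : ∀ x : K₁, algebraMap K₁ K₂ x ≠ s₂)
    {s₃ : L} (hs₃ : s₃ ^ 2 = algebraMap K₂ L (2 + s₂)) (hs₃K : ∀ x : K₂, algebraMap K₂ L x ≠ s₃)
    (hreal : 0 < NumberField.InfinitePlace.nrRealPlaces L) {n : ℕ} (hrank : rank L < n + 1)
    (u : Fin n → (𝓞 L)ˣ) (a₀ a₁ a₂ a₃ a₄ a₅ a₆ a₇ : Fin n → 𝓞 K) {A₀ A₁ A₂ A₃ A₄ A₅ A₆ A₇ : 𝓞 K} {w b v : 𝓞 L}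
    (hu : ∀ i, (((u i : 𝓞 L)) : L) = algebraMap K L (a₀ i : K) + algebraMap K L (a₁ i : K) * algebraMap K₁ L s₁ + (algebraMap K L (a₂ i : K) + algebraMap K L (a₃ i : K) * algebraMap K₁ L s₁) * algebraMap K₂ L s₂ + (algebraMap K L (a₄ i : K) + algebraMap K L (a₅ i : K) * algebraMap K₁ L s₁ + (algebraMap K L (a₆ i : K) + algebraMap K L (a₇ i : K) * algebraMap K₁ L s₁) * algebraMap K₂ L s₂) * s₃)
    (hw : ((w : 𝓞 L) : L) = algebraMap K L (A₀ : K) + algebraMap K L (A₁ : K) * algebraMap K₁ L s₁ + (algebraMap K L (A₂ : K) + algebraMap K L (A₃ : K) * algebraMap K₁ L s₁) * algebraMap K₂ L s₂ + (algebraMap K L (A₄ : K) + algebraMap K L (A₅ : K) * algebraMap K₁ L s₁ + (algebraMap K L (A₆ : K) + algebraMap K L (A₇ : K) * algebraMap K₁ L s₁) * algebraMap K₂ L s₂) * s₃)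
    (hb : b ≠ 0)
    (hI2 : (Ideal.span {b, v}) ^ 2 = Ideal.span {w, b ^ 2}) (hI4 : (Ideal.span {w, b ^ 2}) ^ 2 = Ideal.span {w})
    (hcert : ∀ (e : Fin n → ℕ) (e' : ℕ) (σ : ℤˣ), (∀ i, e i ≤ 1) → e' ≤ 1 → ¬ (e = 0 ∧ e' = 0 ∧ σ = 1) →
      ∃ (q : ℕ) (ψ : 𝓞 K →+* ZMod q) (t r₁ r₂ r₃ : ZMod q), 2 * t = 1 ∧ r₁ ^ 2 = 2 ∧ r₂ ^ 2 = 2 + r₁ ∧ r₃ ^ 2 = 2 + r₂ ∧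
        ¬ IsSquare (((σ : ℤ) : ZMod q) *
          (∏ i, (ψ (a₀ i) + ψ (a₁ i) * r₁ + (ψ (a₂ i) + ψ (a₃ i) * r₁) * r₂ + (ψ (a₄ i) + ψ (a₅ i) * r₁ + (ψ (a₆ i) + ψ (a₇ i) * r₁) * r₂) * r₃) ^ e i) *
          (ψ A₀ + ψ A₁ * r₁ + (ψ A₂ + ψ A₃ * r₁) * r₂ + (ψ A₄ + ψ A₅ * r₁ + (ψ A₆ + ψ A₇ * r₁) * r₂) * r₃) ^ e')) :
    4 ∣ Nat.card (ClassGroup (𝓞 L)) := by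
  obtain ⟨c, hc⟩ := exists_orderOf_eq_four_of_tower3OrderFourCert h1 h2 h3 hs₁ hs₁K hs₂ hs₂K hs₃ hs₃K hreal hrank u
    a₀ a₁ a₂ a₃ a₄ a₅ a₆ a₇ hu hw hb hI2 hI4 hcert
  rw [← hc]
  exact orderOf_dvd_natCard c

end Main3

/-! ## §4 The character matrix for the three-step tower -/

section CharMatrix3

/-- ★ **THE CHARACTER MATRIX supplies the residue certificates (three-step symbols).**  Generators `g = (−1, u_0, …, u_{n−1}, w)` indexed by `Fin (n+2)`,
each with eight `R`-coordinates; `m` residue characters (`q` prime, `ψ : R → ℤ/q`, `2t = 1`, `r₁² = 2`, `r₂² = 2 + r₁`, `r₃² = 2 + r₂`) with EULER BITS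
`sym(g_k)^{(q−1)/2} = (−1)^{B_{jk}}`, and `N` over `𝔽₂` with `N·B = 1` ⟹ for every `(e, e', ±) ≠ (0, 0, +)` some character sees
`±∏ sym(u_i)^{e_i} sym(w)^{e'}` as a NON-square.  Proof identical to `towerCert_of_charMatrix`. [cite: Serre1973CourseArithmetic, Ch. I §3 (Euler's criterion)]
[cite: Cohen1993, §6.5 (verifying units modulo squares by quadratic characters)] -/
theorem tower3Cert_of_charMatrix {R : Type*} [CommRing R] {n m : ℕ} (a₀ a₁ a₂ a₃ a₄ a₅ a₆ a₇ : Fin n → R) (A₀ A₁ A₂ A₃ A₄ A₅ A₆ A₇ : R)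
    (B : Fin m → Fin (n + 2) → ZMod 2) (N : Fin (n + 2) → Fin m → ZMod 2)
    (hNB : ∀ k i, ∑ j, N k j * B j i = if k = i then 1 else 0)
    (hchar : ∀ j : Fin m, ∃ (q : ℕ) (_ : Fact q.Prime) (ψ : R →+* ZMod q) (t r₁ r₂ r₃ : ZMod q),
      2 * t = 1 ∧ r₁ ^ 2 = 2 ∧ r₂ ^ 2 = 2 + r₁ ∧ r₃ ^ 2 = 2 + r₂ ∧
      (-1 : ZMod q) ^ (q / 2) = (-1) ^ (B j 0).val ∧
      (∀ i : Fin n, (ψ (a₀ i) + ψ (a₁ i) * r₁ + (ψ (a₂ i) + ψ (a₃ i) * r₁) * r₂ + (ψ (a₄ i) + ψ (a₅ i) * r₁ + (ψ (a₆ i) + ψ (a₇ i) * r₁) * r₂) * r₃) ^ (q / 2) =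
        (-1) ^ (B j i.castSucc.succ).val) ∧
      (ψ A₀ + ψ A₁ * r₁ + (ψ A₂ + ψ A₃ * r₁) * r₂ + (ψ A₄ + ψ A₅ * r₁ + (ψ A₆ + ψ A₇ * r₁) * r₂) * r₃) ^ (q / 2) = (-1) ^ (B j (Fin.last (n + 1))).val) :
    ∀ (e : Fin n → ℕ) (e' : ℕ) (σ : ℤˣ), (∀ i, e i ≤ 1) → e' ≤ 1 → ¬ (e = 0 ∧ e' = 0 ∧ σ = 1) →
      ∃ (q : ℕ) (ψ : R →+* ZMod q) (t r₁ r₂ r₃ : ZMod q), 2 * t = 1 ∧ r₁ ^ 2 = 2 ∧ r₂ ^ 2 = 2 + r₁ ∧ r₃ ^ 2 = 2 + r₂ ∧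
        ¬ IsSquare (((σ : ℤ) : ZMod q) *
          (∏ i, (ψ (a₀ i) + ψ (a₁ i) * r₁ + (ψ (a₂ i) + ψ (a₃ i) * r₁) * r₂ + (ψ (a₄ i) + ψ (a₅ i) * r₁ + (ψ (a₆ i) + ψ (a₇ i) * r₁) * r₂) * r₃) ^ e i) *
          (ψ A₀ + ψ A₁ * r₁ + (ψ A₂ + ψ A₃ * r₁) * r₂ + (ψ A₄ + ψ A₅ * r₁ + (ψ A₆ + ψ A₇ * r₁) * r₂) * r₃) ^ e') := by
  classical
  intro e e' σ he he' hne
  set Es : ℕ := if σ = 1 then 0 else 1 with hEs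
  set E : Fin (n + 2) → ℕ := Fin.cons Es (Fin.snoc e e') with hE
  set ε : Fin (n + 2) → ZMod 2 := fun k => (E k : ZMod 2) with hε
  have hE0 : E 0 = Es := by rw [hE, Fin.cons_zero]
  have hEi : ∀ i : Fin n, E i.castSucc.succ = e i := fun i => by rw [hE, Fin.cons_succ, Fin.snoc_castSucc]
  have hEl : E (Fin.last (n + 1)) = e' := by rw [hE, ← Fin.succ_last, Fin.cons_succ, Fin.snoc_last]
  have hε0 : ε ≠ 0 := by
    intro h
    apply hne
    have hk : ∀ k, (E k : ZMod 2) = 0 := fun k => congrFun h k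
    refine ⟨?_, ?_, ?_⟩
    · ext i
      have h1 := hk i.castSucc.succ
      rw [hEi] at h1
      have := he i
      interval_cases (e i)
      · rfl
      · exact absurd h1 (by decide)
    · have h1 := hk (Fin.last (n + 1))
      rw [hEl] at h1
      interval_cases e'
      · rfl
      · exact absurd h1 (by decide)
    · have h1 := hk 0
      rw [hE0, hEs] at h1
      by_contra hσ
      rw [if_neg hσ] at h1
      exact absurd h1 (by decide)
  have hrow : ∃ j, ∑ k, B j k * ε k = 1 := by
    by_contra hall
    have key : ∀ x : ZMod 2, x ≠ 1 → x = 0 := by decide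
    have hall0 : ∀ j, ∑ k, B j k * ε k = 0 := fun j => key _ fun h => hall ⟨j, h⟩
    apply hε0
    ext k
    have : ε k = ∑ i, (if k = i then 1 else 0) * ε i := by
      rw [Finset.sum_eq_single k (fun i _ hik => by rw [if_neg (Ne.symm hik), zero_mul]) (fun h => absurd (Finset.mem_univ k) h),
        if_pos rfl, one_mul]
    rw [this, Pi.zero_apply]
    calc ∑ i, (if k = i then 1 else 0) * ε i = ∑ i, (∑ j, N k j * B j i) * ε i := by
          refine Finset.sum_congr rfl fun i _ => ?_; rw [hNB]
      _ = ∑ j, N k j * ∑ i, B j i * ε i := by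
          simp_rw [Finset.sum_mul, Finset.mul_sum, mul_assoc]
          rw [Finset.sum_comm]
      _ = 0 := by simp_rw [hall0, mul_zero, Finset.sum_const_zero]
  obtain ⟨j, hj⟩ := hrow
  obtain ⟨q, hq, ψ, t, r₁, r₂, r₃, ht, hr₁, hr₂, hr₃, hs, hu, hw⟩ := hchar j
  refine ⟨q, ψ, t, r₁, r₂, r₃, ht, hr₁, hr₂, hr₃, not_isSquare_of_pow_div_two_eq_neg_one ht ?_⟩
  have hσ : ((σ : ℤ) : ZMod q) = (-1) ^ Es := by
    rcases Int.units_eq_one_or σ with rfl | rfl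
    · rw [hEs, if_pos rfl]; simp
    · rw [hEs, if_neg (by decide)]; simp
  have hpow : ∀ {x : ZMod q} {b' : ℕ}, x ^ (q / 2) = (-1) ^ b' → ∀ E' : ℕ, (x ^ E') ^ (q / 2) = (-1) ^ (b' * E') := by
    intro x b' hx E'
    rw [← pow_mul, mul_comm, pow_mul, hx, ← pow_mul]
  set M : ℕ := (B j 0).val * Es + ∑ i, (B j i.castSucc.succ).val * e i + (B j (Fin.last (n + 1))).val * e' with hM
  have hP : (((σ : ℤ) : ZMod q) *
      (∏ i, (ψ (a₀ i) + ψ (a₁ i) * r₁ + (ψ (a₂ i) + ψ (a₃ i) * r₁) * r₂ + (ψ (a₄ i) + ψ (a₅ i) * r₁ + (ψ (a₆ i) + ψ (a₇ i) * r₁) * r₂) * r₃) ^ e i) *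
      (ψ A₀ + ψ A₁ * r₁ + (ψ A₂ + ψ A₃ * r₁) * r₂ + (ψ A₄ + ψ A₅ * r₁ + (ψ A₆ + ψ A₇ * r₁) * r₂) * r₃) ^ e') ^ (q / 2) = (-1) ^ M := by
    rw [mul_pow, mul_pow, ← Finset.prod_pow, hσ, hpow hs, hpow hw,
      Finset.prod_congr rfl fun i _ => hpow (hu i) (e i), Finset.prod_pow_eq_pow_sum, hM, pow_add, pow_add]
  have hMε : (M : ZMod 2) = ∑ k, B j k * ε k := by
    rw [Fin.sum_univ_succ, Fin.sum_univ_castSucc, hM]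
    push_cast
    simp only [ZMod.natCast_val, ZMod.cast_id', id_eq, hε, hE0, hEi, Fin.succ_last, hEl]
    rw [add_assoc]
  rw [hj] at hMε
  have hModd : Odd M := ZMod.natCast_eq_one_iff_odd.mp hMε
  rw [hP, hModd.neg_one_pow]

end CharMatrix3

end Literature.NumberTheory.NumberFields

end
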